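import Mathlib
import Literature.MathematicalPhysics.QuantumFieldTheory.MagnenRivasseauSeneor1993.MRS93MainStatementPinned
import Literature.MathematicalPhysics.QuantumFieldTheory.MagnenRivasseauSeneor1993.MRS93MainStatementLimit
import Literature.MathematicalPhysics.QuantumFieldTheory.MagnenRivasseauSeneor1993.MRS93PositionSpaceFields
import HarnessLib

/-!
# Magnen–Rivasseau–Sénéor, *Construction of YM₄ with an infrared cutoff* (CMP 155, 1993), §VIII (VIII.4)–(VIII.6)
# p.377–378 «applied to two test functions of x and y»: THE PRINTED LEFT-HAND SIDE OF THE SLAVNOV IDENTITIES AS A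
# FUNCTIONAL OF THE CUT-OFF FIELD IN POSITION SPACE, and its EXPLICIT finitary Ward datum for the pinned carrier

statement-level bookkeeping of a published display with citation tags; every theorem kernel-checked (0 `sorry`, 0 new
named facts); nothing here is a claim about the Yang–Mills mass gap, about continuum Yang–Mills on `T⁴` without infrared
cutoff, or about the Clay problem — and nothing of Magnen–Rivasseau–Sénéor's expansion, of their derivation of the Ward
identities, or of the infrared correction `E_N` is asserted or formalised

**Citation header (reproduction of PUBLISHED work).** J. Magnen, V. Rivasseau, R. Sénéor, *Construction of YM₄ with an
infrared cutoff*, Commun. Math. Phys. **155** (1993) 325–383 [MagnenRivasseauSeneor1993], Sect. VIII pp. 377–378. Loci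
`p.NNN tl.nn` = journal page and text-layer line of the held scan `paper:magnen1993-cmp155-mrs-ym4-infrared-cutoff`
(PDF page = journal page − 324); the displays (VIII.4)–(VIII.6) were read on the page images of record
`renders-cmp155/p53_full_s6.png`, `p54_full_s6.png` (`run/shared/lean/pub/lit-balaban/inprint/lit-balaban-p14/`).
Cell pub-balaban-gaps (YM blitz, track G3), seat mrs-lit-1 (statement layer), gen 21; companion record
`run/shared/lean/pub/pub-balaban-gaps/g3/MRS-AS-PRINTED.md`. Sibling modules used BY NAME, nothing re-typed:
`…MRS93MainStatementPinned` (gen 0: the pinned carrier `PinnedTheory` — `Mode`, `Config`, `monomial`, `schwinger`,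
`WardData`, `finitaryWard`, the FREE field `wardData`, `PrintedStatement`), `…MRS93MainStatementLimit` (gen 19:
`tendsto_schwinger_Slim`, `slavnov_finitary`), `…MRS93PositionSpaceFields` (gen 9: `Pos`, `vol`, `chi`, `trigPoly`,
`field`, `pderiv`, integration by parts, `IsRealOn`, `RealCoeff`), `…MRS93AxialYMAction` (`coeff`),
`…MRS93TruncatedGauge` (`eps`); `…MRS93SlavnovHierarchy` (mrs-lit-2: the FORMAL (VIII.4)/(VIII.5) as predicates on the
abstract carrier) is not imported and nothing of it is restated.

**Why this leaf.** The pinned carrier types the left-hand side of (VIII.6) only by its SHAPE — docstring (K4) of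
`…MRS93MainStatementPinned`: «a finite linear combination (coefficients: momenta, `λ`, `δ^{ab}`, `ε_abc`) of values of the
`(N−2)`-, `(N−1)`- and `N`-point functions ⟶ field `wardData N x` … The Fourier-space coefficients themselves are NOT fixed
here». This leaf supplies THE PRINTED INSTANCE: the displays (VIII.4)/(VIII.5) applied to cut-off test functions, as
functionals of the cut-off configuration in position space, PROVED to be finitary Ward evaluations with explicit
`WardData`.

**What the paper prints (verbatim, page image p.377 [PDF 53]).** tl.28–35: *«This identity gives rise to a hierarchy of
identities with any number N of external sources. For instance the two point function identity is obtained by applying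
one functional derivative δ/δJ(y) to (VIII.3) and is simply (exchanging the names of x and y);
⟨A^a_m(x)[∂/∂y^n A^b_n(y)](∂/∂y⁰)²⟩_ax = δ_{ab}δ(x − y) ∂/∂y^m. (VIII.4) We should of course understand this identity as
applied to two test functions of x and y.»*; tl.36–39: *«Similarly we can write e.g. an identity involving N point
functions: ⟨Σ_{i=1}^{N−1} (Π_{j=1,j≠i}^{N−1} A^{a_j}_{m_j}(x_j)) D^{a_ib}_{m_i}δ(x_i − y) − Π_{j=1}^{N−1} A^{a_j}_{m_j}(x_j)
[∂/∂y^n A^b_n(y)](∂/∂y⁰)²⟩_ax = 0. (VIII.5)»*; p.378 [PDF 54] tl.2–12: *«For a theory with a fixed infrared-cutoff of a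
given type, the linear term in γ for a gauge transformation A → A + Dγ receives a contribution from the presence in
(VIII.1) of the cutoff. This leads to correction terms in the Slavnov identities. For example Eq. (VIII.5) takes the form
⟨[the same left-hand side]⟩_ax = E_N({x_j}), (VIII.6) where E_N can be computed for any given infrared cutoff.»*;
tl.13–22: *«The identities (VIII.6) are those that we are going to check in the limit ρ → ∞. … These identities take the
form of equality between the left-hand side of (VIII.6) where ⟨·⟩_ax is replaced by ⟨·⟩_{ax,ρ}, the normalized functional
integral of our theory with cutoff and a right-hand side which is no longer E_N, but E_N + δ_N(ρ) … When ρ → ∞, the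
left-hand side, made of normalized Schwinger functions with cutoff ρ, by definition tends to the same Schwinger
functions without ultraviolet cutoff that we have constructed.»* The covariant derivative is (II.5) p.329 tl.10–11,
«D = ∂ − λ[A, ·]» (typed pointwise by gen 5, `…InfinitesimalGauge.covD`, bracket `[X, Y]^a = Σ ε_{abc}X^bY^c`).

**What is typed here (0 `sorry`, 0 new named facts; every theorem kernel-checked).**
* §1 `linC M c A = Σ_{m∈M} c_m A(m)` — complex linear forms in finitely many real coordinates; **`prod_linC`**: a product
  of `n` of them is `Σ_{t∈Π_jM_j}(Π_j c_{j,t_j})·monomial t A` (`Finset.prod_univ_sum`); `modesOver S` (all real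
  coordinates over a momentum window), `pairW`/`pairCoeff`/**`linC_pairCoeff`** (the pairing `Σ_{p∈S} w(p)Ã^a_μ(p)` as
  such a form); `wardList`/`sum_wardList`/`finitaryWard_append` (Finset-indexed families as `WardData` lists,
  `Finset.sum_map_toList`); for the pinned carrier: **`PinnedTheory.integral_prod_linC`** —
  `⟨Π_jL_j⟩_{ax,ρ} = Σ_t (Π_j c_{j,t_j})·S_ρ(n, t)` («made of normalized Schwinger functions with cutoff ρ»),
  `re_integral_prod_linC`, `integral_linC` (one-point functions), integrability lemmas.
* §2 **SMEARED CUT-OFF FIELDS IN POSITION SPACE** for test functions `f = trigPoly K d` on `Λ`: `testWeight K d p = d_{−p}`,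
  `integral_trigPoly_mul_sum_chi`; **`smear_field_eq`** `∫_Λ f A^a_μ = Σ_{p∈S} d_{−p}Ã^a_μ(p)`; `pderiv_field_sum`,
  **`smear_pderiv_field_eq`** `∫_Λ f ∂_νA^a_μ = Σ_p d_{−p}(ip_ν)Ã^a_μ(p)`; `testWeight₂`, `integral_trigPoly_mul_trigPoly_mul_sum_chi`,
  **`smear₂_field_eq`** `∫_Λ f g A^c_μ = Σ_p(Σ_{q+r=−p}d_qe_r)Ã^c_μ(p)` (the bracket part of `D^{a_ib}_{m_i}δ(x_i − y)`).
* §3 **(VIII.4) APPLIED TO `f` (in `x`) AND `g` (in `y`)**: `deltaTerm` = `δ_{ab}∫_Λ f ∂_m g` (+ `deltaTerm_eq_neg`: the other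
  placement `−δ_{ab}∫_Λ(∂_m f)g` is the same number), **`wardTwo S K d L e a b m A`**
  `= A^a_m(f)·Σ_{n=1}^{3}∫_Λ(∂₀²g)∂_nA^b_n − δ_{ab}∫_Λ f∂_m g` (left-hand side minus right-hand side of (VIII.4), LITERALLY as
  position-space integrals of the synthesised cut-off field); `integral_d2time_mul_eq` (`∫(∂₀²g)F = ∫g ∂₀²F`: the placement of
  `(∂/∂y⁰)²` is immaterial); **`wardTwo_eq`** (closed form: product of the two linear forms `twoCoeff` minus the constant);
  **`wardDataTwo`** `: WardData` and **`PinnedTheory.finitaryWard_wardDataTwo`**: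
  `finitaryWard (S_ρ) wardDataTwo = Re ∫ W₂ d⟨·⟩_{ax,ρ}` for EVERY pinned theory and every `ρ` (`…'` with `Re` inside);
  `integral_wardTwo`; **`tendsto_re_integral_wardTwo`**: if `T.wardData 2 x = wardDataTwo …` then `T.PrintedStatement` gives
  `Re⟨W₂⟩_{ax,ρ} → E₂(x)` — (VIII.6) at `N = 2` with the printed left-hand side; `…_formal` (`E₂ = 0`: (VIII.4) itself).
* §4 **(VIII.5)/(VIII.6) FOR `N = n + 2` SOURCES**: **`wardN S λ K d a m L e b A`** — the printed left-hand side with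
  `D^{a_ib}_{m_i} = δ_{a_ib}∂_{m_i} − λ Σ_c ε_{a_icb}A^c_{m_i}` acting on the test function of `y` and smeared with `f_i`, the
  product over `j ≠ i` indexed by `Fin.succAbove` (`prod_eq_mul_prod_succAbove`); `smCoeff`/`epsCoeff`/`divCoeff`,
  `coeffA`/`coeffB`/`coeffC`, **`wardN_eq`** (closed form), **`wardDataN`** and **`PinnedTheory.finitaryWard_wardDataN`**
  (`= Re ∫ W_N d⟨·⟩_{ax,ρ}`: the `(N−2)`-, `(N−1)`-, `N`-point functions with explicit coefficients — (K4) INSTANTIATED),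
  `integral_wardN`, **`tendsto_re_integral_wardN`** ((VIII.6) with the printed left-hand side under `PrintedStatement`).
* §4 PRECISION (ae), kernel-exhibited: **`wardN_zero_eq`** — at `N = 2` the general display (VIII.5) equals `−W₂ − λΣ_cε_{acb}∫_Λ fgA^c_m`:
  (VIII.4) omits the one-point bracket term `−λε_{acb}⟨A^c_m(y)⟩δ(x − y)` that `⟨D^{ab}_m⟩` produces; it vanishes whenever
  the one-point functions do (`PinnedTheory.integral_wardN_zero_of_onePoint`; e.g. by the global colour invariance of
  p.347 tl.19–22, which is not a clause of the typed carrier). Not claimed to be an error: a symmetric-theory simplification.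
* §5 REALITY: for real test functions (`RealCoeff`) and configurations obeying `Ã(−p) = conj Ã(p)` (`IsRealOn`, the
  support of MRS's measures by `…PositionSpaceFields.ae_isRealOn_muZero`) every smeared quantity is real and
  **`wardTwo_im_eq_zero`**, **`wardN_im_eq_zero`** — the real parts carried by the Ward data ARE the printed numbers there.
* §6 (EDITION v1.1, append-only; every v1 declaration byte-identical, imports unchanged) **THE PINNED CARRIER WITH THE
  PRINTED SLAVNOV DATA**: `Slavnov.TestDatum n` (the printed Ward test datum for `N = n + 2` sources: test functions
  `f_j`, `g`, colours, spatial indices), `WTestPrinted` (none for `N < 2`, READING (N)), `TestDatum.W` / `TestDatum.data`,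
  **`wardDataPrinted`** (the printed instance of (K4)'s free `wardData`), **`PinnedTheory.withPrintedSlavnov T S λ E`**
  (same parameters, laws and axial gauge as `T`; Ward data := the printed ones; `E` a datum on printed test data),
  `withPrintedSlavnov_schwinger` / `_law`, `uvLimit_withPrintedSlavnov_iff`, `isMRSTheory_withPrintedSlavnov`, and
  **`printedStatement_withPrintedSlavnov_iff`**: for such a theory MRS's main statement `PrintedStatement` HOLDS IFF the
  ultraviolet limit of every Schwinger function exists AND for every `N = n + 2` and every printed test datum `x`,
  `Re⟨W_N(x)⟩_{ax,ρ} → E_N(x)` — the second conjunct of p.327 tl.39–43 expressed through the printed displays (VIII.5)/(VIII.6)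
  and the laws `⟨·⟩_{ax,ρ}` alone (`…_formal_iff`: the `E ≡ 0` case = the formal hierarchy (VIII.5)).
* §7 (EDITION v1.1) **READING (T) AS A THEOREM**: `testWeightL f p = ∫_Λ f e^{ip·x}`, `integrable_mul_chi`,
  **`smear_field_eq_general`** (ANY integrable test function smears the cut-off field through its window coefficients
  only: `∫_Λ f A^a_μ = Σ_{p∈S}(∫_Λ f e^{ip·x})Ã^a_μ(p)`), `testWeightL_trigPoly` (= `d_{−p}` for trigonometric polynomials).
* §8 (EDITION v1.2) **THE SECT. VIII REDUCTION WITH THE PRINTED LEFT-HAND SIDE** (p.378 tl.13–25):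
  **`approximateSlavnov_withPrintedSlavnov_iff`** — for the theory carrying the printed Slavnov data the «approximate
  identities» `ApproximateSlavnovPrinted … δ` UNFOLD to `Re⟨W_N(x)⟩_{ax,ρ} = E_N(x) + δ_N(x)(ρ)` for all printed test data and
  all `ρ`; **`printedStatement_withPrintedSlavnov_of_sectVIII`** — UV limit ∧ these identities ∧ `δ_N(x)(ρ) → 0` ⟹ MRS's main
  statement for that theory (gen 0's `mainStatement_of_sectVIII` in printed vocabulary; the three hypotheses ARE the paper's
  analytic content, a self-declared sketch — nothing of them proved).
* §9 (EDITION v1.3) **THE VACUITY FRONTIER OF `…MRS93MainStatementPinned` WITH THE PRINTED LEFT-HAND SIDE** (honest,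
  PROVED): at the zero configuration `W₂(0) = −δ_{ab}∫_Λ f∂_m g` (`wardTwo_zero_config`), `W_N(0) =` the δ-term at `N = 2`
  and `0` at `N ≥ 3` in the (VIII.5) form (`wardN_zero_config_zero` / `_succ`); the zero-field carrier `diracModel` of
  `…MRS93MainStatementPinned` equipped with the printed Slavnov data and an infrared-correction datum `E` satisfies MRS's
  statement IFF `E_N(x) = Re W_N(x)(0)` (**`diracModel_withPrintedSlavnov_printedStatement_iff`**). Consequences: the FORMAL
  identities (VIII.4)/(VIII.5) (`E ≡ 0`) now EXCLUDE the zero field (**`not_printedStatement_diracModel_withPrintedSlavnov_formal`**,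
  witness datum `f = e^{−ie_m·x}`, `g = −ie^{ie_m·x}`, `a = b`: `δ_{ab}∫_Λ f∂_m g = 1`, `deltaTerm_witness`), and so does the
  recipe «`E_N :=` constant term of the Ward functional» by which `diracModel_mainStatement` passed — with the printed data
  plugged into its own slots that carrier IS the `E ≡ 0` one (`diracModel_printed_eq`) and FAILS
  (**`not_printedStatement_diracModel_printed`**; the hypothesis «every listed term has arity ≥ 1» of `diracModel_mainStatement`
  is violated by the print: the δ-term of (VIII.4) multiplies the zero-point function); but with `E := ezero` (`Re(δ-term)` at
  `N = 2`, `0` at `N ≥ 3`) it SURVIVES (**`diracModel_withPrintedSlavnov_ezero_printedStatement`**,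
  `exists_withPrintedSlavnov_printedStatement`). The frontier therefore sits EXACTLY at «`E_N` can be computed for any given
  infrared cutoff» (p.378 tl.9) not being computed in print: (K4) instantiated gives the formal hierarchy content, not (VIII.6).
* §10 (EDITION v1.4) **THE SLAVNOV CONJUNCT IS DEFINITIONAL WHILE `E_N` IS A FREE DATUM** (the general form of gen 2's
  `gaussianRefModelE_printedStatement`, now with the printed left-hand side and for EVERY pinned theory): `PinnedTheory.limitE`
  (`E_N(x) :=` the finitary Ward functional of the LIMIT Schwinger functions at the printed datum — the limit that exists «by
  definition», p.378 tl.20–22), **`printedStatement_withPrintedSlavnov_limitE`** (UV limit ⟹ MRS's statement with the printed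
  Slavnov data and `E := limitE`), **`uvLimit_iff_exists_E_printedStatement`** (`UVLimitExistsPrinted T ↔ ∃ E,
  (T.withPrintedSlavnov S λ E).PrintedStatement`): as long as `E_N` is not printed, the typed main statement WITH the printed
  left-hand side is equivalent to its first conjunct up to the choice of `E`; §9 says which natural choices (`E ≡ 0`, gen 0's
  constant term) do carry content.

**Readings (declared).** (P) position space and Fourier conventions are those of `…PositionSpaceFields` (flat torus of
period `2π` at unit volume, characters `e^{ik·x}`, `∂_μ ↔ ik_μ`; READING (P′)/(D) there). (R1) in (VIII.4)/(VIII.5) the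
differential operators written to the right of the kernel — `(∂/∂y⁰)²` and the `∂/∂y^m`, `D^{a_ib}_{m_i}` attached to
`δ(x − y)` — act on the test function of `y` (for `(∂/∂y⁰)²` the placement is immaterial, `integral_d2time_mul_eq`; for
`∂/∂y^m` the other placement flips a sign, `deltaTerm_eq_neg` — the sign that the derivation from (VIII.3) fixes is the one
typed: `δ/δJ^a_m` of `J^c_n D^{cb}_n γ^b` gives `(D_mγ)^a`, the derivative ON the test function). (m) latin indices
`m, n ∈ {1,2,3}` are spatial (axial gauge), as in gen 7's `…AxialWardIdentity` and gen 9's `opVIII3_jetAt`. (λ) the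
coupling multiplying `[A, ·]` in `D` is a parameter `lam` ((K4): bare or renormalised is not said in print). (T) test
functions are cut-off (trigonometric-polynomial) functions on `Λ`; since the field itself is cut off at the window `S`, an
arbitrary test function acts only through its coefficients `d_{−p}`, `p ∈ S` (`smear_field_eq`), so nothing is lost.
(Re) `WardData` is real: the data carry real parts; §5 shows the functionals are real where MRS's measures live.
(N) `N − 1 = n + 1 ≥ 1` field points (the display's `Σ_{i=1}^{N−1}`, `Π_{j=1}^{N−1}` are over a nonempty range).

**EDITION v1.1 (gen 21, append-only).** §6 and §7 added after the landed v1 (p399241); §§1–5 byte-identical; imports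
unchanged; this docstring gained the §6/§7 bullets and this paragraph.
**EDITION v1.2 (gen 21, append-only).** §8 added after the landed v1.1 (p399576); §§1–7 byte-identical; imports unchanged;
this docstring gained the §8 bullet and this line.
**EDITION v1.3 (gen 22, append-only).** §9 added after the landed v1.2 (p399879); §§1–8 byte-identical; imports unchanged;
this docstring gained the §9 bullet and this line.
**EDITION v1.4 (gen 22, append-only).** §10 added after the landed v1.3 (p401871); §§1–9 byte-identical; imports unchanged;
this docstring gained the §10 bullet and this line.

**What is NOT claimed or typed.** The derivation (VIII.1) → (VIII.5) (change of variables `A → A + Dγ`, «no first order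
dependence in γ», functional derivatives in `J` — the first-variation side at finite cutoff is gen 7/gen 9's
`…AxialWardIdentity`/`…PositionSpaceFields` §§11–12); any formula for `E_N` or `δ_N(ρ)`; that a given pinned theory's
`wardData` IS `wardDataTwo`/`wardDataN` (the carrier leaves it free — the limit theorems here are stated under that
equation as a hypothesis, which is how a consumer instantiates (K4) with the print); perturbative renormalisability;
anything of Sects. III–VII; anything of Bałaban's. MRS work at FIXED INFRARED CUTOFF (p.328 tl.4–5): nothing here bears
on infinite volume or a mass gap.
-/

noncomputable section

open MeasureTheory Finset Complex Filter Topology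
open scoped ComplexConjugate

namespace Literature.MathematicalPhysics.QuantumFieldTheory.MagnenRivasseauSeneor1993

namespace MainStatement

open PositionSpace TruncatedGauge

namespace Slavnov

/-! ## §1 Complex linear forms of finitely many real coordinates; their products are finite combinations of the
Schwinger integrands `monomial` -/

/-- A complex LINEAR FORM in finitely many real field coordinates: `L(A) = Σ_{m∈M} c_m·A(m)` (every smeared
component `A^a_μ(f) = ∫_Λ f A^a_μ` of a cut-off field is of this shape, §2). [cite: MagnenRivasseauSeneor1993, (VIII.1) p.377, p.378 tl.20–21] -/
def linC (M : Finset Mode) (c : Mode → ℂ) (A : Config) : ℂ := ∑ m ∈ M, c m * (A m : ℂ)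

/-- Linear forms add in the coefficient. [cite: MagnenRivasseauSeneor1993, p.378 tl.20–21] -/
theorem linC_finset_sum {ι : Type*} (s : Finset ι) (M : Finset Mode) (c : ι → Mode → ℂ) (A : Config) :
    linC M (fun m => ∑ i ∈ s, c i m) A = ∑ i ∈ s, linC M (c i) A := by
  unfold linC
  simp_rw [Finset.sum_mul]
  rw [Finset.sum_comm]

/-- **A PRODUCT OF `n` LINEAR FORMS IS A FINITE COMBINATION OF `n`-POINT SCHWINGER INTEGRANDS**:
`Π_j (Σ_{m∈M_j} c_{j,m} A(m)) = Σ_{t ∈ Π_j M_j} (Π_j c_{j,t_j}) · Π_j A(t_j)`. [cite: MagnenRivasseauSeneor1993, (VIII.1) p.377, p.378 tl.20–21 («made of normalized Schwinger functions»)] -/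
theorem prod_linC {n : ℕ} (M : Fin n → Finset Mode) (c : Fin n → Mode → ℂ) (A : Config) :
    ∏ j, linC (M j) (c j) A = ∑ t ∈ Fintype.piFinset M, (∏ j, c j (t j)) * (monomial t A : ℂ) := by
  unfold linC
  rw [Finset.prod_univ_sum]
  refine Finset.sum_congr rfl fun t _ => ?_
  rw [monomial, Complex.ofReal_prod, ← Finset.prod_mul_distrib]

/-- ALL real coordinates `(p, μ, a, Re/Im)` over a momentum window `S` — the common index set of the linear forms
below. [cite: MagnenRivasseauSeneor1993, §II.A p.328 tl.12–19] -/
def modesOver (S : Finset Momentum) : Finset Mode := S ×ˢ (Finset.univ ×ˢ (Finset.univ ×ˢ Finset.univ))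

/-- Summation over `modesOver S`, unfolded. [cite: MagnenRivasseauSeneor1993, §II.A p.328 tl.12–19] -/
theorem sum_modesOver (S : Finset Momentum) (F : Mode → ℂ) :
    ∑ m ∈ modesOver S, F m = ∑ p ∈ S, ∑ μ : Fin 4, ∑ a : Fin 3, ∑ β : Bool, F (p, μ, a, β) := by
  unfold modesOver
  rw [Finset.sum_product]
  refine Finset.sum_congr rfl fun p _ => ?_
  rw [Finset.sum_product]
  refine Finset.sum_congr rfl fun μ _ => ?_
  rw [Finset.sum_product]

/-- The momentum-space PAIRING `Σ_{p∈S} w(p)·Ã^a_μ(p)` of a weight `w` with one component of the configuration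
(`coeff A p μ a = Re Ã^a_μ(p) + i·Im Ã^a_μ(p)`, `…MRS93AxialYMAction`). [cite: MagnenRivasseauSeneor1993, §II.A p.328 tl.12–19, (VIII.4) p.377 tl.34–35] -/
def pairW (S : Finset Momentum) (w : Momentum → ℂ) (μ : Fin 4) (a : Fin 3) (A : Config) : ℂ :=
  ∑ p ∈ S, w p * coeff A p μ a

/-- The coefficient function on real coordinates of the pairing `pairW S w μ a`: weight `w(p)` on `Re Ã^a_μ(p)`,
`i·w(p)` on `Im Ã^a_μ(p)`, zero on the other components. [cite: MagnenRivasseauSeneor1993, §II.A p.328 tl.12–19] -/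
def pairCoeff (w : Momentum → ℂ) (μ : Fin 4) (a : Fin 3) : Mode → ℂ := fun m =>
  if m.2.1 = μ ∧ m.2.2.1 = a then (bif m.2.2.2 then w m.1 * I else w m.1) else 0

/-- The pairing IS the linear form with coefficients `pairCoeff` on `modesOver S`.
[cite: MagnenRivasseauSeneor1993, §II.A p.328 tl.12–19, p.378 tl.20–21] -/
theorem linC_pairCoeff (S : Finset Momentum) (w : Momentum → ℂ) (μ : Fin 4) (a : Fin 3) (A : Config) :
    linC (modesOver S) (pairCoeff w μ a) A = pairW S w μ a A := by
  unfold linC pairW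
  rw [sum_modesOver]
  refine Finset.sum_congr rfl fun p _ => ?_
  rw [Finset.sum_eq_single_of_mem μ (Finset.mem_univ μ) (fun μ' _ hne => by simp [pairCoeff, hne])]
  rw [Finset.sum_eq_single_of_mem a (Finset.mem_univ a) (fun a' _ hne => by simp [pairCoeff, hne])]
  simp only [pairCoeff, and_self, if_true, Fintype.sum_bool, cond_true, cond_false, coeff]
  ring

/-- A finite family of product terms `(z_i, t_i)` of common arity `n` as the LIST part of a finitary Ward datum
(`…MRS93MainStatementPinned.WardData`). [cite: MagnenRivasseauSeneor1993, (VIII.6) p.378 tl.20–21] -/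
def wardList {ι : Type*} (I : Finset ι) (z : ι → ℝ) (n : ℕ) (t : ι → Fin n → Mode) :
    List (ℝ × Σ k : ℕ, Fin k → Mode) :=
  I.toList.map fun i => (z i, ⟨n, t i⟩)

/-- Evaluating the list part: `Σ_i z_i · G(n, t_i)`. [cite: MagnenRivasseauSeneor1993, (VIII.6) p.378 tl.20–21] -/
theorem sum_wardList {ι : Type*} (I : Finset ι) (z : ι → ℝ) (n : ℕ) (t : ι → Fin n → Mode)
    (G : (k : ℕ) → (Fin k → Mode) → ℝ) :
    ((wardList I z n t).map fun u => u.1 * G u.2.1 u.2.2).sum = ∑ i ∈ I, z i * G n (t i) := by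
  unfold wardList
  rw [List.map_map]
  exact Finset.sum_map_toList I _

/-- `finitaryWard` of a datum whose list is a concatenation. [cite: MagnenRivasseauSeneor1993, (VIII.6) p.378 tl.20–21] -/
theorem finitaryWard_append (G : (k : ℕ) → (Fin k → Mode) → ℝ) (c₀ : ℝ) (l₁ l₂ : List (ℝ × Σ k : ℕ, Fin k → Mode)) :
    finitaryWard G (c₀, l₁ ++ l₂) =
      c₀ + ((l₁.map fun u => u.1 * G u.2.1 u.2.2).sum + (l₂.map fun u => u.1 * G u.2.1 u.2.2).sum) := by
  unfold finitaryWard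
  rw [List.map_append, List.sum_append]

end Slavnov

namespace PinnedTheory

open Slavnov

variable (T : PinnedTheory)

/-- The Schwinger integrands are integrable as complex functions ((K3): all moments finite).
[cite: MagnenRivasseauSeneor1993, p.378 tl.17–21] -/
theorem integrable_monomial_complex (ρ n : ℕ) (t : Fin n → Mode) :
    Integrable (fun A => (monomial t A : ℂ)) (T.law ρ) :=
  (T.integrable ρ n t).ofReal

/-- Products of linear forms are integrable for every `⟨·⟩_{ax,ρ}`. [cite: MagnenRivasseauSeneor1993, p.378 tl.17–21] -/
theorem integrable_prod_linC (ρ : ℕ) {n : ℕ} (M : Fin n → Finset Mode) (c : Fin n → Mode → ℂ) :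
    Integrable (fun A => ∏ j, linC (M j) (c j) A) (T.law ρ) := by
  have h : (fun A => ∏ j, linC (M j) (c j) A) =
      fun A => ∑ t ∈ Fintype.piFinset M, (∏ j, c j (t j)) * (monomial t A : ℂ) :=
    funext fun A => prod_linC M c A
  rw [h]
  exact integrable_finsetSum _ fun t _ => (T.integrable_monomial_complex ρ n t).const_mul _

/-- **`⟨Π_j L_j⟩_{ax,ρ} = Σ_t (Π_j c_{j,t_j}) · S_ρ(n, t)`**: the expectation of a product of `n` linear forms in the
cut-off theory is the corresponding finite combination of cut-off `n`-point Schwinger functions — «the left-hand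
side, made of normalized Schwinger functions with cutoff ρ». [cite: MagnenRivasseauSeneor1993, p.378 tl.17–21, (VIII.1) p.377] -/
theorem integral_prod_linC (ρ : ℕ) {n : ℕ} (M : Fin n → Finset Mode) (c : Fin n → Mode → ℂ) :
    ∫ A, ∏ j, linC (M j) (c j) A ∂(T.law ρ) =
      ∑ t ∈ Fintype.piFinset M, (∏ j, c j (t j)) * (T.schwinger ρ n t : ℂ) := by
  have h : (fun A => ∏ j, linC (M j) (c j) A) =
      fun A => ∑ t ∈ Fintype.piFinset M, (∏ j, c j (t j)) * (monomial t A : ℂ) :=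
    funext fun A => prod_linC M c A
  rw [h, integral_finsetSum _ fun t _ => (T.integrable_monomial_complex ρ n t).const_mul _]
  refine Finset.sum_congr rfl fun t _ => ?_
  rw [integral_const_mul, PinnedTheory.schwinger, ← integral_complex_ofReal]

/-- Real part of such an expectation: `Σ_t Re(Π_j c_{j,t_j}) · S_ρ(n, t)` (the Schwinger functions are real).
[cite: MagnenRivasseauSeneor1993, p.378 tl.17–21] -/
theorem re_integral_prod_linC (ρ : ℕ) {n : ℕ} (M : Fin n → Finset Mode) (c : Fin n → Mode → ℂ) :
    (∫ A, ∏ j, linC (M j) (c j) A ∂(T.law ρ)).re =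
      ∑ t ∈ Fintype.piFinset M, (∏ j, c j (t j)).re * T.schwinger ρ n t := by
  rw [T.integral_prod_linC ρ M c, Complex.re_sum]
  refine Finset.sum_congr rfl fun t _ => ?_
  rw [Complex.re_mul_ofReal]

end PinnedTheory

namespace Slavnov

/-! ## §2 Test functions and SMEARED cut-off fields in position space («applied to two test functions of x and y»,
p.377 tl.34–35): `∫_Λ f·A^a_μ`, `∫_Λ f·∂_νA^a_μ` and `∫_Λ f g·A^a_μ` are pairings `pairW` with explicit weights -/

variable (S : Finset Momentum)

/-- The WEIGHT of the test function `f = Σ_{k∈K} d_k e^{ik·x}` seen by the mode `p` of the field: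
`∫_Λ f(x) e^{ip·x} d⁴x = d_{−p}` (zero if `−p ∉ K`). [cite: MagnenRivasseauSeneor1993, (VIII.4) p.377 tl.34–35, §II.A p.328 tl.12–15] -/
def testWeight (K : Finset (Fin 4 → ℤ)) (d : (Fin 4 → ℤ) → ℂ) (p : Momentum) : ℂ :=
  if -p.1 ∈ K then d (-p.1) else 0

/-- `∫_Λ f(x)·(Σ_{p∈S} c_p e^{ip·x}) d⁴x = Σ_{p∈S} d_{−p} c_p` (orthogonality of characters, `…PositionSpaceFields.integral_chi`).
[cite: MagnenRivasseauSeneor1993, §II.A p.328 tl.12–15, (VIII.4) p.377 tl.34–35] -/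
theorem integral_trigPoly_mul_sum_chi (K : Finset (Fin 4 → ℤ)) (d : (Fin 4 → ℤ) → ℂ) (c : Momentum → ℂ) :
    ∫ x, trigPoly K d x * ∑ p ∈ S, c p * chi p.1 x ∂vol = ∑ p ∈ S, testWeight K d p * c p := by
  have h : ∀ x, trigPoly K d x * ∑ p ∈ S, c p * chi p.1 x =
      ∑ p ∈ S, ∑ k ∈ K, (d k * c p) * chi (k + p.1) x := by
    intro x
    unfold trigPoly
    rw [Finset.sum_mul_sum, Finset.sum_comm]
    refine Finset.sum_congr rfl fun p _ => Finset.sum_congr rfl fun k _ => ?_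
    rw [chi_add]
    ring
  simp_rw [h]
  rw [integral_finsetSum _ fun p _ => integrable_finsetSum _ fun k _ => (integrable_chi _).const_mul _]
  refine Finset.sum_congr rfl fun p _ => ?_
  rw [integral_finsetSum _ fun k _ => (integrable_chi _).const_mul _]
  simp_rw [integral_const_mul, integral_chi, add_eq_zero_iff_eq_neg, mul_ite, mul_one, mul_zero]
  rw [Finset.sum_ite_eq']
  unfold testWeight
  split_ifs <;> simp

/-- **THE SMEARED FIELD COMPONENT** `A^a_μ(f) := ∫_Λ f(x) A^a_μ(x) d⁴x = Σ_{p∈S} d_{−p} Ã^a_μ(p)` for the cut-off field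
`A^a_μ(x) = Σ_{p∈S} Ã^a_μ(p)e^{ip·x}` (`…PositionSpaceFields.field`) and the test function `f = trigPoly K d`.
[cite: MagnenRivasseauSeneor1993, (VIII.4) p.377 tl.32–35] -/
theorem smear_field_eq (K : Finset (Fin 4 → ℤ)) (d : (Fin 4 → ℤ) → ℂ) (μ : Fin 4) (a : Fin 3) (A : Config) :
    ∫ x, trigPoly K d x * field S A μ a x ∂vol = pairW S (testWeight K d) μ a A := by
  unfold field pairW
  exact integral_trigPoly_mul_sum_chi S K d fun p => coeff A p μ a

/-- `∂_νA^a_μ(x) = Σ_{p∈S} (ip_ν)Ã^a_μ(p) e^{ip·x}` over the window itself. [cite: MagnenRivasseauSeneor1993, (II.1) p.328 tl.28–30] -/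
theorem pderiv_field_sum (A : Config) (μ : Fin 4) (a : Fin 3) (ν : Fin 4) (x : Pos) :
    pderiv ν (field S A μ a) x = ∑ p ∈ S, (I * (p.1 ν : ℂ) * coeff A p μ a) * chi p.1 x := by
  rw [pderiv_field]
  unfold trigPoly
  exact sum_convSupport_coeffZ_complex S A (fun k C => I * (k ν : ℂ) * C μ a * chi k x) fun k => by simp

/-- **THE SMEARED DERIVATIVE** `∫_Λ f(x) ∂_νA^a_μ(x) d⁴x = Σ_{p∈S} d_{−p}(ip_ν) Ã^a_μ(p)`.
[cite: MagnenRivasseauSeneor1993, (VIII.4) p.377 tl.32–35, (II.1) p.328] -/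
theorem smear_pderiv_field_eq (K : Finset (Fin 4 → ℤ)) (d : (Fin 4 → ℤ) → ℂ) (μ : Fin 4) (a : Fin 3) (ν : Fin 4)
    (A : Config) :
    ∫ x, trigPoly K d x * pderiv ν (field S A μ a) x ∂vol =
      pairW S (fun p => testWeight K d p * (I * (p.1 ν : ℂ))) μ a A := by
  simp_rw [pderiv_field_sum]
  rw [integral_trigPoly_mul_sum_chi]
  unfold pairW
  refine Finset.sum_congr rfl fun p _ => ?_
  ring

/-- The weight of the PRODUCT of two test functions `f·g` (`f = trigPoly K d`, `g = trigPoly L e`) seen by the mode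
`p`: `Σ_{q∈K, r∈L, q+r=−p} d_q e_r`. [cite: MagnenRivasseauSeneor1993, (VIII.5) p.377 tl.36–39, §II.A p.328 tl.12–15] -/
def testWeight₂ (K : Finset (Fin 4 → ℤ)) (d : (Fin 4 → ℤ) → ℂ) (L : Finset (Fin 4 → ℤ)) (e : (Fin 4 → ℤ) → ℂ)
    (p : Momentum) : ℂ :=
  ∑ q ∈ K, ∑ r ∈ L, if q + r = -p.1 then d q * e r else 0

/-- `∫_Λ f(x)g(x)·(Σ_{p∈S} c_p e^{ip·x}) d⁴x = Σ_{p∈S} (Σ_{q+r=−p} d_q e_r) c_p`. [cite: MagnenRivasseauSeneor1993, (VIII.5) p.377 tl.36–39, §II.A p.328 tl.12–15] -/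
theorem integral_trigPoly_mul_trigPoly_mul_sum_chi (K : Finset (Fin 4 → ℤ)) (d : (Fin 4 → ℤ) → ℂ)
    (L : Finset (Fin 4 → ℤ)) (e : (Fin 4 → ℤ) → ℂ) (c : Momentum → ℂ) :
    ∫ x, trigPoly K d x * trigPoly L e x * ∑ p ∈ S, c p * chi p.1 x ∂vol = ∑ p ∈ S, testWeight₂ K d L e p * c p := by
  have h : ∀ x, trigPoly K d x * trigPoly L e x * ∑ p ∈ S, c p * chi p.1 x =
      ∑ p ∈ S, ∑ q ∈ K, ∑ r ∈ L, (d q * e r * c p) * chi (q + r + p.1) x := by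
    intro x
    rw [trigPoly_mul_trigPoly, Finset.sum_mul_sum, Finset.sum_comm]
    refine Finset.sum_congr rfl fun p _ => Finset.sum_congr rfl fun q _ => ?_
    rw [Finset.sum_mul]
    refine Finset.sum_congr rfl fun r _ => ?_
    rw [chi_add (q + r)]
    ring
  simp_rw [h]
  rw [integral_finsetSum _ fun p _ => integrable_finsetSum _ fun q _ => integrable_finsetSum _ fun r _ =>
    (integrable_chi _).const_mul _]
  refine Finset.sum_congr rfl fun p _ => ?_
  rw [integral_finsetSum _ fun q _ => integrable_finsetSum _ fun r _ => (integrable_chi _).const_mul _]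
  unfold testWeight₂
  rw [Finset.sum_mul]
  refine Finset.sum_congr rfl fun q _ => ?_
  rw [integral_finsetSum _ fun r _ => (integrable_chi _).const_mul _, Finset.sum_mul]
  refine Finset.sum_congr rfl fun r _ => ?_
  simp only [integral_const_mul, integral_chi, add_eq_zero_iff_eq_neg]
  split_ifs <;> simp

/-- **THE FIELD SMEARED WITH A PRODUCT OF TEST FUNCTIONS** `∫_Λ f(y)g(y) A^c_μ(y) d⁴y = Σ_{p∈S}(Σ_{q+r=−p} d_q e_r)Ã^c_μ(p)`
(the `λ[A, ·]` part of `D^{a_ib}_{m_i}δ(x_i − y)` in (VIII.5) smeared with `f_i(x_i)` and `g(y)`).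
[cite: MagnenRivasseauSeneor1993, (VIII.5) p.377 tl.36–39, (II.5) p.329 tl.10–11] -/
theorem smear₂_field_eq (K : Finset (Fin 4 → ℤ)) (d : (Fin 4 → ℤ) → ℂ) (L : Finset (Fin 4 → ℤ)) (e : (Fin 4 → ℤ) → ℂ)
    (μ : Fin 4) (a : Fin 3) (A : Config) :
    ∫ x, trigPoly K d x * trigPoly L e x * field S A μ a x ∂vol = pairW S (testWeight₂ K d L e) μ a A := by
  unfold field pairW
  exact integral_trigPoly_mul_trigPoly_mul_sum_chi S K d L e fun p => coeff A p μ a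

/-! ## §3 (VIII.4) «applied to two test functions of x and y» AS A FUNCTIONAL OF THE CUT-OFF FIELD, and its Ward datum -/

/-- Coefficients of `∂₀²g` for `g = trigPoly L e`: `(ik₀)(ik₀)e_k` (`…PositionSpaceFields.pderiv_pderiv_trigPoly`).
[cite: MagnenRivasseauSeneor1993, (VIII.4) p.377 tl.32–33] -/
def d2time (e : (Fin 4 → ℤ) → ℂ) : (Fin 4 → ℤ) → ℂ := fun k => I * (k 0 : ℂ) * (I * (k 0 : ℂ) * e k)

/-- `∂₀∂₀g` is the trigonometric polynomial with coefficients `d2time e`. [cite: MagnenRivasseauSeneor1993, (VIII.4) p.377 tl.32–33] -/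
theorem pderiv_pderiv_time_trigPoly (L : Finset (Fin 4 → ℤ)) (e : (Fin 4 → ℤ) → ℂ) (y : Pos) :
    pderiv 0 (pderiv 0 (trigPoly L e)) y = trigPoly L (d2time e) y :=
  pderiv_pderiv_trigPoly L e 0 0 y

/-- **THE δ-TERM OF (VIII.4) ON THE TEST FUNCTIONS**: `δ_{ab} δ(x − y) ∂/∂y^m` applied to `f(x)`, `g(y)` is
`δ_{ab} ∫_Λ f(y) (∂_m g)(y) d⁴y` (READING (R1): in the display the differential operators stand to the right of the
kernel and act on the test function of `y`, as `(∂/∂y⁰)²` does on the left-hand side; the other placement,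
`−δ_{ab}∫_Λ (∂_m f) g`, is the same number — `deltaTerm_eq_neg`). Latin indices are spatial, `m ∈ {1,2,3}` (READING (m)
of `…MRS93AxialWardIdentity`). [cite: MagnenRivasseauSeneor1993, (VIII.4) p.377 tl.32–35] -/
def deltaTerm (K : Finset (Fin 4 → ℤ)) (d : (Fin 4 → ℤ) → ℂ) (L : Finset (Fin 4 → ℤ)) (e : (Fin 4 → ℤ) → ℂ)
    (a b : Fin 3) (m : Fin 3) : ℂ :=
  if a = b then ∫ y, trigPoly K d y * pderiv m.succ (trigPoly L e) y ∂vol else 0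

/-- The two placements of `∂/∂y^m` in the δ-term agree up to the sign that integration by parts on the torus
produces: `∫_Λ f ∂_m g = −∫_Λ (∂_m f) g`. [cite: MagnenRivasseauSeneor1993, (VIII.4) p.377 tl.32–35, p.377 tl.26 («Integrating by parts»)] -/
theorem deltaTerm_eq_neg (K : Finset (Fin 4 → ℤ)) (d : (Fin 4 → ℤ) → ℂ) (L : Finset (Fin 4 → ℤ)) (e : (Fin 4 → ℤ) → ℂ)
    (m : Fin 3) :
    ∫ y, trigPoly K d y * pderiv m.succ (trigPoly L e) y ∂vol = -∫ y, pderiv m.succ (trigPoly K d) y * trigPoly L e y ∂vol := by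
  rw [integral_pderiv_mul_eq_neg, neg_neg]

/-- **(VIII.4) APPLIED TO THE TEST FUNCTIONS `f` (in `x`) AND `g` (in `y`), LEFT-HAND SIDE MINUS RIGHT-HAND SIDE, AS A
FUNCTIONAL OF THE CUT-OFF CONFIGURATION** — p.377 tl.28–35, verbatim: «For instance the two point function identity is
obtained by applying one functional derivative δ/δJ(y) to (VIII.3) and is simply (exchanging the names of x and y);
⟨A^a_m(x)[∂/∂y^n A^b_n(y)](∂/∂y⁰)²⟩_ax = δ_{ab}δ(x − y) ∂/∂y^m. (VIII.4) We should of course understand this identity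
as applied to two test functions of x and y.»: `W₂(A) = A^a_m(f) · Σ_{n=1}^{3} ∫_Λ (∂₀²g)(y) ∂_nA^b_n(y) d⁴y − δ_{ab}∫_Λ f ∂_m g`
with `A^a_m(f) = ∫_Λ f(x)A^a_m(x)d⁴x`; `f = trigPoly K d`, `g = trigPoly L e` cut-off test functions on `Λ`. The
identity (VIII.4) is the FORMAL statement `⟨W₂⟩_ax = 0`; what MRS assert for their theory is (VIII.6), `= E₂(f, g)` in
the limit `ρ → ∞` (`tendsto_re_integral_wardTwo`). [cite: MagnenRivasseauSeneor1993, (VIII.4) p.377 tl.28–35] -/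
def wardTwo (K : Finset (Fin 4 → ℤ)) (d : (Fin 4 → ℤ) → ℂ) (L : Finset (Fin 4 → ℤ)) (e : (Fin 4 → ℤ) → ℂ)
    (a b : Fin 3) (m : Fin 3) (A : Config) : ℂ :=
  (∫ x, trigPoly K d x * field S A m.succ a x ∂vol) *
      (∑ n : Fin 3, ∫ y, pderiv 0 (pderiv 0 (trigPoly L e)) y * pderiv n.succ (field S A n.succ b) y ∂vol) -
    deltaTerm K d L e a b m

/-- READING CHECK for the placement of `(∂/∂y⁰)²`: letting it act on the field instead of on the test function gives the
same smeared quantity, `∫_Λ (∂₀²g)(∂_nA^b_n) = ∫_Λ g ∂₀²(∂_nA^b_n)` (two integrations by parts on the torus; here for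
any two cut-off functions). [cite: MagnenRivasseauSeneor1993, (VIII.4) p.377 tl.32–35, p.377 tl.26 («Integrating by parts»)] -/
theorem integral_d2time_mul_eq (L : Finset (Fin 4 → ℤ)) (e : (Fin 4 → ℤ) → ℂ) (K : Finset (Fin 4 → ℤ))
    (c : (Fin 4 → ℤ) → ℂ) :
    ∫ y, pderiv 0 (pderiv 0 (trigPoly L e)) y * trigPoly K c y ∂vol =
      ∫ y, trigPoly L e y * pderiv 0 (pderiv 0 (trigPoly K c)) y ∂vol := by
  have h1 : pderiv 0 (trigPoly L e) = trigPoly L (fun k => I * (k 0 : ℂ) * e k) :=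
    funext fun y => pderiv_trigPoly L e 0 y
  have h2 : pderiv 0 (trigPoly K c) = trigPoly K (fun k => I * (k 0 : ℂ) * c k) :=
    funext fun y => pderiv_trigPoly K c 0 y
  rw [h1, integral_pderiv_mul_eq_neg, h2, ← h1, integral_pderiv_mul_eq_neg, neg_neg]

/-- The weight of the smeared divergence term: mode `p` of `A^b_n` enters `∫_Λ(∂₀²g)∂_nA^b_n` with
`(d2time e)_{−p}·(ip_n)`. [cite: MagnenRivasseauSeneor1993, (VIII.4) p.377 tl.32–33] -/
def divWeight (L : Finset (Fin 4 → ℤ)) (e : (Fin 4 → ℤ) → ℂ) (n : Fin 3) : Momentum → ℂ :=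
  fun p => testWeight L (d2time e) p * (I * (p.1 n.succ : ℂ))

/-- The two linear forms of (VIII.4) as coefficient functions on `modesOver S`: `j = 0` ↦ `A^a_m(f)`,
`j = 1` ↦ `Σ_n ∫_Λ(∂₀²g)∂_nA^b_n`. [cite: MagnenRivasseauSeneor1993, (VIII.4) p.377 tl.32–33] -/
def twoCoeff (K : Finset (Fin 4 → ℤ)) (d : (Fin 4 → ℤ) → ℂ) (L : Finset (Fin 4 → ℤ)) (e : (Fin 4 → ℤ) → ℂ)
    (a b : Fin 3) (m : Fin 3) : Fin 2 → Mode → ℂ :=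
  ![pairCoeff (testWeight K d) m.succ a, fun md => ∑ n : Fin 3, pairCoeff (divWeight L e n) n.succ b md]

/-- **(VIII.4) IN CLOSED FORM**: `W₂(A) = L₀(A)·L₁(A) − δ_{ab}∫_Λ f∂_m g` with the two linear forms `twoCoeff` of the real
coordinates over the window. [cite: MagnenRivasseauSeneor1993, (VIII.4) p.377 tl.28–35] -/
theorem wardTwo_eq (K : Finset (Fin 4 → ℤ)) (d : (Fin 4 → ℤ) → ℂ) (L : Finset (Fin 4 → ℤ)) (e : (Fin 4 → ℤ) → ℂ)
    (a b : Fin 3) (m : Fin 3) (A : Config) :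
    wardTwo S K d L e a b m A =
      (∏ j : Fin 2, linC (modesOver S) (twoCoeff K d L e a b m j) A) - deltaTerm K d L e a b m := by
  rw [wardTwo, Fin.prod_univ_two]
  simp only [twoCoeff, Matrix.cons_val_zero, Matrix.cons_val_one]
  rw [linC_pairCoeff, smear_field_eq, linC_finset_sum]
  congr 2
  refine Finset.sum_congr rfl fun n _ => ?_
  simp_rw [pderiv_pderiv_time_trigPoly]
  rw [smear_pderiv_field_eq, linC_pairCoeff]
  rfl

/-- **THE WARD DATUM OF (VIII.4)**: the PRINTED left-hand side (minus right-hand side) as an element of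
`WardData` — constant `−Re(δ_{ab}∫_Λ f∂_m g)` and, for every pair `t = (t₀, t₁)` of real coordinates over the window,
the coefficient `Re(c⁰_{t₀} c¹_{t₁})` on the two-point function at `t`. This is the instance of (K4)'s abstract
`wardData 2 ·` of `…MRS93MainStatementPinned` that the print fixes, under READINGS (P) (Fourier conventions of
`…PositionSpaceFields`), (R1), (m). [cite: MagnenRivasseauSeneor1993, (VIII.4) p.377 tl.28–35, (VIII.6) p.378 tl.5–8, tl.20–21] -/
def wardDataTwo (K : Finset (Fin 4 → ℤ)) (d : (Fin 4 → ℤ) → ℂ) (L : Finset (Fin 4 → ℤ)) (e : (Fin 4 → ℤ) → ℂ)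
    (a b : Fin 3) (m : Fin 3) : WardData :=
  (-(deltaTerm K d L e a b m).re,
    wardList (Fintype.piFinset fun _ : Fin 2 => modesOver S)
      (fun t => (∏ j, twoCoeff K d L e a b m j (t j)).re) 2 fun t => t)

end Slavnov

namespace PinnedTheory

open Slavnov

variable (T : PinnedTheory) (S : Finset Momentum)

/-- `W₂` is integrable for every `⟨·⟩_{ax,ρ}`. [cite: MagnenRivasseauSeneor1993, (VIII.4) p.377, p.378 tl.17–21] -/
theorem integrable_wardTwo (K : Finset (Fin 4 → ℤ)) (d : (Fin 4 → ℤ) → ℂ) (L : Finset (Fin 4 → ℤ)) (e : (Fin 4 → ℤ) → ℂ)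
    (a b : Fin 3) (m : Fin 3) (ρ : ℕ) :
    Integrable (wardTwo S K d L e a b m) (T.law ρ) := by
  have h : wardTwo S K d L e a b m =
      fun A => (∏ j : Fin 2, linC (modesOver S) (twoCoeff K d L e a b m j) A) - deltaTerm K d L e a b m :=
    funext fun A => wardTwo_eq S K d L e a b m A
  haveI := T.isProb ρ
  rw [h]
  exact (T.integrable_prod_linC ρ _ _).sub (integrable_const _)

/-- **`⟨W₂⟩_{ax,ρ}` IN SCHWINGER FUNCTIONS**: `∫ W₂ d⟨·⟩_{ax,ρ} = Σ_t (c⁰_{t₀}c¹_{t₁})·S_ρ(2, t) − δ_{ab}∫_Λ f∂_m g`.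
[cite: MagnenRivasseauSeneor1993, (VIII.4) p.377 tl.28–35, p.378 tl.17–21] -/
theorem integral_wardTwo (K : Finset (Fin 4 → ℤ)) (d : (Fin 4 → ℤ) → ℂ) (L : Finset (Fin 4 → ℤ)) (e : (Fin 4 → ℤ) → ℂ)
    (a b : Fin 3) (m : Fin 3) (ρ : ℕ) :
    ∫ A, wardTwo S K d L e a b m A ∂(T.law ρ) =
      (∑ t ∈ Fintype.piFinset fun _ : Fin 2 => modesOver S,
          (∏ j, twoCoeff K d L e a b m j (t j)) * (T.schwinger ρ 2 t : ℂ)) - deltaTerm K d L e a b m := by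
  have h : wardTwo S K d L e a b m =
      fun A => (∏ j : Fin 2, linC (modesOver S) (twoCoeff K d L e a b m j) A) - deltaTerm K d L e a b m :=
    funext fun A => wardTwo_eq S K d L e a b m A
  haveI := T.isProb ρ
  rw [h, integral_sub (T.integrable_prod_linC ρ _ _) (integrable_const _), T.integral_prod_linC, integral_const]
  simp

/-- **THE PRINTED LEFT-HAND SIDE OF (VIII.4) IS A FINITARY WARD EVALUATION**: for every cutoff `ρ`,
`finitaryWard (S_ρ) (wardDataTwo) = Re ∫ W₂ d⟨·⟩_{ax,ρ}` — (K4) of `…MRS93MainStatementPinned` («a finite linear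
combination … of values of the Schwinger functions») instantiated by the print.
[cite: MagnenRivasseauSeneor1993, (VIII.4) p.377 tl.28–35, (VIII.6) p.378 tl.16–21] -/
theorem finitaryWard_wardDataTwo (K : Finset (Fin 4 → ℤ)) (d : (Fin 4 → ℤ) → ℂ) (L : Finset (Fin 4 → ℤ))
    (e : (Fin 4 → ℤ) → ℂ) (a b : Fin 3) (m : Fin 3) (ρ : ℕ) :
    finitaryWard (T.schwinger ρ) (wardDataTwo S K d L e a b m) = (∫ A, wardTwo S K d L e a b m A ∂(T.law ρ)).re := by
  rw [T.integral_wardTwo, wardDataTwo, finitaryWard, sum_wardList, Complex.sub_re, Complex.re_sum]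
  simp_rw [Complex.re_mul_ofReal]
  ring

/-- … equivalently with the real part inside the integral. [cite: MagnenRivasseauSeneor1993, (VIII.4) p.377 tl.28–35, p.378 tl.16–21] -/
theorem finitaryWard_wardDataTwo' (K : Finset (Fin 4 → ℤ)) (d : (Fin 4 → ℤ) → ℂ) (L : Finset (Fin 4 → ℤ))
    (e : (Fin 4 → ℤ) → ℂ) (a b : Fin 3) (m : Fin 3) (ρ : ℕ) :
    finitaryWard (T.schwinger ρ) (wardDataTwo S K d L e a b m) = ∫ A, (wardTwo S K d L e a b m A).re ∂(T.law ρ) := by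
  rw [T.finitaryWard_wardDataTwo]
  have h := integral_re (T.integrable_wardTwo S K d L e a b m ρ)
  simp only [RCLike.re_to_complex] at h
  exact h.symm

/-- **(VIII.6) AT `N = 2` WITH THE PRINTED LEFT-HAND SIDE**: if the pinned theory's two-source Ward datum at the test
datum `x` IS `wardDataTwo` (the print's), then under MRS's main statement `Re⟨W₂⟩_{ax,ρ} → E₂(x)` as `ρ → ∞` —
«The identities (VIII.6) are those that we are going to check in the limit ρ → ∞ … the left-hand side, made of
normalized Schwinger functions with cutoff ρ, by definition tends to the same Schwinger functions without ultraviolet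
cutoff» (p.378 tl.13–22). `E₂` is NOT computed (no formula is printed). [cite: MagnenRivasseauSeneor1993, (VIII.6) p.378 tl.5–22, p.327 tl.39–43] -/
theorem tendsto_re_integral_wardTwo (h : T.PrintedStatement) (K : Finset (Fin 4 → ℤ)) (d : (Fin 4 → ℤ) → ℂ)
    (L : Finset (Fin 4 → ℤ)) (e : (Fin 4 → ℤ) → ℂ) (a b : Fin 3) (m : Fin 3) {x : T.WTest 2}
    (hx : T.wardData 2 x = wardDataTwo S K d L e a b m) :
    Tendsto (fun ρ => (∫ A, wardTwo S K d L e a b m A ∂(T.law ρ)).re) atTop (𝓝 (T.E 2 x)) := by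
  have hlim := tendsto_finitaryWard (G := fun ρ => T.schwinger ρ) (Glim := T.toAxialTheory.Slim)
    (fun n f => T.tendsto_schwinger_Slim h.1 n f) (T.wardData 2 x)
  rw [T.slavnov_finitary h 2 x] at hlim
  simp_rw [hx, T.finitaryWard_wardDataTwo] at hlim
  exact hlim

/-- The FORMAL identity (VIII.4) itself, `⟨W₂⟩ = 0`, in the same vocabulary: it is what `E₂ = 0` would give
(`…MRS93SlavnovHierarchy.SlavnovTwoPointPrinted` is this with the abstract datum). [cite: MagnenRivasseauSeneor1993, (VIII.4) p.377 tl.28–35, (VIII.6) p.378 tl.9–12] -/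
theorem tendsto_re_integral_wardTwo_formal (h : T.PrintedStatement) (K : Finset (Fin 4 → ℤ)) (d : (Fin 4 → ℤ) → ℂ)
    (L : Finset (Fin 4 → ℤ)) (e : (Fin 4 → ℤ) → ℂ) (a b : Fin 3) (m : Fin 3) {x : T.WTest 2}
    (hx : T.wardData 2 x = wardDataTwo S K d L e a b m) (hE : T.E 2 x = 0) :
    Tendsto (fun ρ => (∫ A, wardTwo S K d L e a b m A ∂(T.law ρ)).re) atTop (𝓝 0) := by
  rw [← hE]
  exact T.tendsto_re_integral_wardTwo S h K d L e a b m hx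

end PinnedTheory

namespace Slavnov

/-! ## §4 (VIII.5)/(VIII.6) for `N = n + 2` sources «applied to test functions»: the general left-hand side as a
functional of the cut-off field, with the covariant derivative `D = ∂ − λ[A, ·]` of (II.5), and its Ward datum -/

variable (S : Finset Momentum)

/-- Scalars pull out of a linear form. [cite: MagnenRivasseauSeneor1993, p.378 tl.20–21] -/
theorem linC_const_mul (M : Finset Mode) (z : ℂ) (c : Mode → ℂ) (A : Config) :
    linC M (fun md => z * c md) A = z * linC M c A := by
  unfold linC
  rw [Finset.mul_sum]
  refine Finset.sum_congr rfl fun md _ => ?_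
  ring

/-- **(VIII.5)/(VIII.6) APPLIED TO TEST FUNCTIONS, THE LEFT-HAND SIDE AS A FUNCTIONAL OF THE CUT-OFF CONFIGURATION** —
p.377 tl.36–39 (page image `p53_full_s6.png`), verbatim: «Similarly we can write e.g. an identity involving N point
functions: ⟨Σ_{i=1}^{N−1} (Π_{j=1, j≠i}^{N−1} A^{a_j}_{m_j}(x_j)) D^{a_ib}_{m_i} δ(x_i − y) − Π_{j=1}^{N−1} A^{a_j}_{m_j}(x_j)
[∂/∂y^n A^b_n(y)] (∂/∂y⁰)²⟩_ax = 0. (VIII.5)»; p.378 tl.5–8: «Eq. (VIII.5) takes the form ⟨[the same]⟩_ax = E_N({x_j}),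
(VIII.6)». Here `N − 1 = n + 1` field points `x_j` with test functions `f_j = trigPoly (K j) (d j)`, colours `a_j`,
spatial indices `m_j`, and the point `y` with test function `g = trigPoly L e` and colour `b`:
`W_N(A) = Σ_i (Π_{j≠i} A^{a_j}_{m_j}(f_j)) · (δ_{a_ib}∫_Λ f_i ∂_{m_i}g − λ Σ_c ε_{a_i c b} ∫_Λ f_i g A^c_{m_i})
 − (Π_j A^{a_j}_{m_j}(f_j)) · Σ_{n=1}^{3}∫_Λ (∂₀²g) ∂_nA^b_n`,
the operator `D^{a_ib}_{m_i}` being the tree's (II.5) `(D_mγ)^a = ∂_mγ^a − λ[A_m, γ]^a`, `[X, Y]^a = Σ ε_{abc}X^bY^c`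
(`…InfinitesimalGauge.covD`, `TruncatedGauge.eps`) applied to `γ^c = δ_{cb} g` and smeared with `f_i` (READING (R1) as in
`deltaTerm`; the product over `j ≠ i` is indexed through `Fin.succAbove i`). The coupling `λ` multiplying `[A, ·]` is a
PARAMETER (the print does not say whether the bare `λ_ρ` or a renormalised coupling is meant in (VIII.6) — docstring (K4)
of `…MRS93MainStatementPinned`). [cite: MagnenRivasseauSeneor1993, (VIII.5) p.377 tl.36–39, (VIII.6) p.378 tl.2–8, (II.5) p.329 tl.10–11] -/
def wardN (lam : ℝ) {n : ℕ} (K : Fin (n + 1) → Finset (Fin 4 → ℤ)) (d : Fin (n + 1) → (Fin 4 → ℤ) → ℂ)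
    (a m : Fin (n + 1) → Fin 3) (L : Finset (Fin 4 → ℤ)) (e : (Fin 4 → ℤ) → ℂ) (b : Fin 3) (A : Config) : ℂ :=
  (∑ i : Fin (n + 1),
      (∏ k : Fin n, ∫ x, trigPoly (K (i.succAbove k)) (d (i.succAbove k)) x *
          field S A (m (i.succAbove k)).succ (a (i.succAbove k)) x ∂vol) *
        (deltaTerm (K i) (d i) L e (a i) b (m i) -
          (lam : ℂ) * ∑ c : Fin 3, (eps (a i) c b : ℂ) *
            ∫ y, trigPoly (K i) (d i) y * trigPoly L e y * field S A (m i).succ c y ∂vol)) -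
    (∏ j : Fin (n + 1), ∫ x, trigPoly (K j) (d j) x * field S A (m j).succ (a j) x ∂vol) *
      ∑ n' : Fin 3, ∫ y, pderiv 0 (pderiv 0 (trigPoly L e)) y * pderiv n'.succ (field S A n'.succ b) y ∂vol

/-- The printed «Π_{j=1, j≠i}^{N−1}» and the indexing used: `Π_j F_j = F_i · Π_{k} F_{succAbove i k}`.
[cite: MagnenRivasseauSeneor1993, (VIII.5) p.377 tl.36–37] -/
theorem prod_eq_mul_prod_succAbove {n : ℕ} (F : Fin (n + 1) → ℂ) (i : Fin (n + 1)) :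
    ∏ j, F j = F i * ∏ k : Fin n, F (i.succAbove k) :=
  Fin.prod_univ_succAbove F i

/-- Coefficient function of the smeared field `A^{a_j}_{m_j}(f_j)`. [cite: MagnenRivasseauSeneor1993, (VIII.5) p.377 tl.36–39] -/
def smCoeff {n : ℕ} (K : Fin (n + 1) → Finset (Fin 4 → ℤ)) (d : Fin (n + 1) → (Fin 4 → ℤ) → ℂ)
    (a m : Fin (n + 1) → Fin 3) (j : Fin (n + 1)) : Mode → ℂ :=
  pairCoeff (testWeight (K j) (d j)) (m j).succ (a j)

/-- Coefficient function of the bracket term `Σ_c ε_{a_i c b} ∫_Λ f_i g A^c_{m_i}`. [cite: MagnenRivasseauSeneor1993, (VIII.5) p.377 tl.36–39, (II.5) p.329] -/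
def epsCoeff {n : ℕ} (K : Fin (n + 1) → Finset (Fin 4 → ℤ)) (d : Fin (n + 1) → (Fin 4 → ℤ) → ℂ)
    (a m : Fin (n + 1) → Fin 3) (L : Finset (Fin 4 → ℤ)) (e : (Fin 4 → ℤ) → ℂ) (b : Fin 3) (i : Fin (n + 1)) :
    Mode → ℂ :=
  fun md => ∑ c : Fin 3, (eps (a i) c b : ℂ) * pairCoeff (testWeight₂ (K i) (d i) L e) (m i).succ c md

/-- Coefficient function of the smeared divergence `Σ_n ∫_Λ(∂₀²g)∂_nA^b_n`. [cite: MagnenRivasseauSeneor1993, (VIII.5) p.377 tl.38–39] -/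
def divCoeff (L : Finset (Fin 4 → ℤ)) (e : (Fin 4 → ℤ) → ℂ) (b : Fin 3) : Mode → ℂ :=
  fun md => ∑ n' : Fin 3, pairCoeff (divWeight L e n') n'.succ b md

/-- The `n` linear forms of the `i`-th δ-term: `A^{a_j}_{m_j}(f_j)`, `j ≠ i`. [cite: MagnenRivasseauSeneor1993, (VIII.5) p.377 tl.36–37] -/
def coeffA {n : ℕ} (K : Fin (n + 1) → Finset (Fin 4 → ℤ)) (d : Fin (n + 1) → (Fin 4 → ℤ) → ℂ)
    (a m : Fin (n + 1) → Fin 3) (i : Fin (n + 1)) : Fin n → Mode → ℂ :=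
  fun k => smCoeff K d a m (i.succAbove k)

/-- The `n + 1` linear forms of the `i`-th bracket term: the `A^{a_j}_{m_j}(f_j)`, `j ≠ i`, and the bracket form.
[cite: MagnenRivasseauSeneor1993, (VIII.5) p.377 tl.36–37, (II.5) p.329] -/
def coeffB {n : ℕ} (K : Fin (n + 1) → Finset (Fin 4 → ℤ)) (d : Fin (n + 1) → (Fin 4 → ℤ) → ℂ)
    (a m : Fin (n + 1) → Fin 3) (L : Finset (Fin 4 → ℤ)) (e : (Fin 4 → ℤ) → ℂ) (b : Fin 3) (i : Fin (n + 1)) :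
    Fin (n + 1) → Mode → ℂ :=
  Fin.snoc (α := fun _ => Mode → ℂ) (coeffA K d a m i) (epsCoeff K d a m L e b i)

/-- The `n + 2` linear forms of the divergence term: all `A^{a_j}_{m_j}(f_j)` and the divergence form.
[cite: MagnenRivasseauSeneor1993, (VIII.5) p.377 tl.38–39] -/
def coeffC {n : ℕ} (K : Fin (n + 1) → Finset (Fin 4 → ℤ)) (d : Fin (n + 1) → (Fin 4 → ℤ) → ℂ)
    (a m : Fin (n + 1) → Fin 3) (L : Finset (Fin 4 → ℤ)) (e : (Fin 4 → ℤ) → ℂ) (b : Fin 3) :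
    Fin (n + 2) → Mode → ℂ :=
  Fin.snoc (α := fun _ => Mode → ℂ) (smCoeff K d a m) (divCoeff L e b)

/-- **(VIII.5) IN CLOSED FORM**: `W_N(A) = Σ_i ((Π_k L^A_{i,k}(A))·δ_i − λ·Π_j L^B_{i,j}(A)) − Π_j L^C_j(A)` — every factor a
linear form of the real coordinates over the window. [cite: MagnenRivasseauSeneor1993, (VIII.5) p.377 tl.36–39] -/
theorem wardN_eq (lam : ℝ) {n : ℕ} (K : Fin (n + 1) → Finset (Fin 4 → ℤ)) (d : Fin (n + 1) → (Fin 4 → ℤ) → ℂ)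
    (a m : Fin (n + 1) → Fin 3) (L : Finset (Fin 4 → ℤ)) (e : (Fin 4 → ℤ) → ℂ) (b : Fin 3) (A : Config) :
    wardN S lam K d a m L e b A =
      (∑ i : Fin (n + 1),
          ((∏ k : Fin n, linC (modesOver S) (coeffA K d a m i k) A) * deltaTerm (K i) (d i) L e (a i) b (m i) -
            (lam : ℂ) * ∏ j : Fin (n + 1), linC (modesOver S) (coeffB K d a m L e b i j) A)) -
        ∏ j : Fin (n + 2), linC (modesOver S) (coeffC K d a m L e b j) A := by
  have hsm : ∀ j, ∫ x, trigPoly (K j) (d j) x * field S A (m j).succ (a j) x ∂vol =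
      linC (modesOver S) (smCoeff K d a m j) A := fun j => by
    rw [smear_field_eq, ← linC_pairCoeff]
    rfl
  have heps : ∀ i, ∑ c : Fin 3, (eps (a i) c b : ℂ) *
      ∫ y, trigPoly (K i) (d i) y * trigPoly L e y * field S A (m i).succ c y ∂vol =
        linC (modesOver S) (epsCoeff K d a m L e b i) A := fun i => by
    unfold epsCoeff
    rw [linC_finset_sum]
    refine Finset.sum_congr rfl fun c _ => ?_
    rw [linC_const_mul, linC_pairCoeff, smear₂_field_eq]
  have hdiv : ∑ n' : Fin 3, ∫ y, pderiv 0 (pderiv 0 (trigPoly L e)) y * pderiv n'.succ (field S A n'.succ b) y ∂vol =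
      linC (modesOver S) (divCoeff L e b) A := by
    unfold divCoeff
    rw [linC_finset_sum]
    refine Finset.sum_congr rfl fun n' _ => ?_
    simp_rw [pderiv_pderiv_time_trigPoly]
    rw [smear_pderiv_field_eq, linC_pairCoeff]
    rfl
  unfold wardN
  simp_rw [hsm, heps, hdiv]
  congr 1
  · refine Finset.sum_congr rfl fun i _ => ?_
    rw [Fin.prod_univ_castSucc (fun j : Fin (n + 1) => linC (modesOver S) (coeffB K d a m L e b i j) A)]
    simp only [coeffB, coeffA, Fin.snoc_castSucc, Fin.snoc_last]
    rw [mul_sub, ← mul_assoc, mul_comm (∏ k : Fin n, linC (modesOver S) (smCoeff K d a m (i.succAbove k)) A) (lam : ℂ),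
      mul_assoc]
  · rw [Fin.prod_univ_castSucc (fun j : Fin (n + 2) => linC (modesOver S) (coeffC K d a m L e b j) A)]
    simp only [coeffC, Fin.snoc_castSucc, Fin.snoc_last]

/-- **THE WARD DATUM OF (VIII.5)/(VIII.6) FOR `N = n + 2` SOURCES** — the printed left-hand side as an element of
`WardData`: no constant; for each `i` and each `t ∈ (window modes)^n` the coefficient `Re(δ_i · Π_k c^A_{i,k,t_k})` on the
`n`-point function at `t`; for each `i` and `t ∈ (window modes)^{n+1}` the coefficient `Re(−λ Π_j c^B_{i,j,t_j})` on the
`(n+1)`-point function; for each `t ∈ (window modes)^{n+2}` the coefficient `Re(−Π_j c^C_{j,t_j})` on the `(n+2)`-point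
function — «a finite linear combination (coefficients: momenta, λ, δ^{ab}, ε_abc) of values of the (N−2)-, (N−1)- and
N-point functions» ((K4) of `…MRS93MainStatementPinned`, now INSTANTIATED). [cite: MagnenRivasseauSeneor1993, (VIII.5) p.377 tl.36–39, (VIII.6) p.378 tl.2–8, tl.16–21] -/
def wardDataN (lam : ℝ) {n : ℕ} (K : Fin (n + 1) → Finset (Fin 4 → ℤ)) (d : Fin (n + 1) → (Fin 4 → ℤ) → ℂ)
    (a m : Fin (n + 1) → Fin 3) (L : Finset (Fin 4 → ℤ)) (e : (Fin 4 → ℤ) → ℂ) (b : Fin 3) : WardData :=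
  (0,
    wardList (Finset.univ ×ˢ Fintype.piFinset fun _ : Fin n => modesOver S)
        (fun it => (deltaTerm (K it.1) (d it.1) L e (a it.1) b (m it.1) * ∏ k, coeffA K d a m it.1 k (it.2 k)).re)
        n (fun it => it.2) ++
      (wardList (Finset.univ ×ˢ Fintype.piFinset fun _ : Fin (n + 1) => modesOver S)
          (fun it => (-(lam : ℂ) * ∏ j, coeffB K d a m L e b it.1 j (it.2 j)).re) (n + 1) (fun it => it.2) ++
        wardList (Fintype.piFinset fun _ : Fin (n + 2) => modesOver S)
          (fun t => (-∏ j, coeffC K d a m L e b j (t j)).re) (n + 2) fun t => t))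

/-- PRECISION (ae), kernel-exhibited: at `N = 2` (one field point) the general left-hand side (VIII.5) is MINUS the
(VIII.4) functional MINUS the one-point bracket term `λ Σ_c ε_{acb} ∫_Λ f g A^c_m`, which (VIII.4) does not print (its
expectation vanishes when the one-point functions do, e.g. by the global colour invariance of p.347 tl.19–22 — not a
clause of the typed carrier; `integral_wardN_zero_of_onePoint`). [cite: MagnenRivasseauSeneor1993, (VIII.4)–(VIII.5) p.377 tl.28–39, p.347 tl.19–22] -/
theorem wardN_zero_eq (lam : ℝ) (K : Finset (Fin 4 → ℤ)) (d : (Fin 4 → ℤ) → ℂ) (a m : Fin 3) (L : Finset (Fin 4 → ℤ))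
    (e : (Fin 4 → ℤ) → ℂ) (b : Fin 3) (A : Config) :
    wardN S lam (n := 0) (fun _ => K) (fun _ => d) (fun _ => a) (fun _ => m) L e b A =
      -wardTwo S K d L e a b m A -
        (lam : ℂ) * ∑ c : Fin 3, (eps a c b : ℂ) * ∫ y, trigPoly K d y * trigPoly L e y * field S A m.succ c y ∂vol := by
  unfold wardN wardTwo
  rw [Fin.sum_univ_one, Fin.prod_univ_zero, Fin.prod_univ_one, one_mul]
  ring

end Slavnov

namespace PinnedTheory

open Slavnov

variable (T : PinnedTheory) (S : Finset Momentum)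

/-- A single coordinate, as a complex function of the configuration, is the one-point Schwinger integrand.
[cite: MagnenRivasseauSeneor1993, (VIII.1) p.377] -/
theorem ofReal_eval_eq_monomial (md : Mode) :
    (fun A : Config => (A md : ℂ)) = fun A => (monomial ![md] A : ℂ) := by
  funext A
  simp [monomial]

/-- Linear forms are integrable for every `⟨·⟩_{ax,ρ}`. [cite: MagnenRivasseauSeneor1993, p.378 tl.17–21] -/
theorem integrable_linC (ρ : ℕ) (M : Finset Mode) (c : Mode → ℂ) : Integrable (linC M c) (T.law ρ) := by
  have h : linC M c = fun A => ∑ md ∈ M, c md * (monomial ![md] A : ℂ) := by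
    funext A
    unfold linC
    exact Finset.sum_congr rfl fun md _ => by rw [← congrFun (ofReal_eval_eq_monomial md) A]
  rw [h]
  exact integrable_finsetSum _ fun md _ => (T.integrable_monomial_complex ρ 1 _).const_mul _

/-- `⟨L⟩_{ax,ρ} = Σ_m c_m S_ρ(1, m)`: the expectation of a linear form is a combination of one-point functions.
[cite: MagnenRivasseauSeneor1993, p.378 tl.17–21] -/
theorem integral_linC (ρ : ℕ) (M : Finset Mode) (c : Mode → ℂ) :
    ∫ A, linC M c A ∂(T.law ρ) = ∑ md ∈ M, c md * (T.schwinger ρ 1 ![md] : ℂ) := by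
  have h : linC M c = fun A => ∑ md ∈ M, c md * (monomial ![md] A : ℂ) := by
    funext A
    unfold linC
    exact Finset.sum_congr rfl fun md _ => by rw [← congrFun (ofReal_eval_eq_monomial md) A]
  rw [h, integral_finsetSum _ fun md _ => (T.integrable_monomial_complex ρ 1 _).const_mul _]
  refine Finset.sum_congr rfl fun md _ => ?_
  rw [integral_const_mul, PinnedTheory.schwinger, ← integral_complex_ofReal]

/-- `W_N` is integrable for every `⟨·⟩_{ax,ρ}`. [cite: MagnenRivasseauSeneor1993, (VIII.5) p.377, p.378 tl.17–21] -/
theorem integrable_wardN (lam : ℝ) {n : ℕ} (K : Fin (n + 1) → Finset (Fin 4 → ℤ)) (d : Fin (n + 1) → (Fin 4 → ℤ) → ℂ)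
    (a m : Fin (n + 1) → Fin 3) (L : Finset (Fin 4 → ℤ)) (e : (Fin 4 → ℤ) → ℂ) (b : Fin 3) (ρ : ℕ) :
    Integrable (wardN S lam K d a m L e b) (T.law ρ) := by
  have h : wardN S lam K d a m L e b = fun A =>
      (∑ i : Fin (n + 1),
          ((∏ k : Fin n, linC (modesOver S) (coeffA K d a m i k) A) * deltaTerm (K i) (d i) L e (a i) b (m i) -
            (lam : ℂ) * ∏ j : Fin (n + 1), linC (modesOver S) (coeffB K d a m L e b i j) A)) -
        ∏ j : Fin (n + 2), linC (modesOver S) (coeffC K d a m L e b j) A :=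
    funext fun A => wardN_eq S lam K d a m L e b A
  rw [h]
  refine (integrable_finsetSum _ fun i _ => ?_).sub (T.integrable_prod_linC ρ _ _)
  exact ((T.integrable_prod_linC ρ _ _).mul_const _).sub ((T.integrable_prod_linC ρ _ _).const_mul _)

/-- **`⟨W_N⟩_{ax,ρ}` IN SCHWINGER FUNCTIONS** — the printed left-hand side «made of normalized Schwinger functions with
cutoff ρ» (p.378 tl.20–21): `(N−2)`-, `(N−1)`- and `N`-point functions with the explicit coefficients.
[cite: MagnenRivasseauSeneor1993, (VIII.5) p.377 tl.36–39, (VIII.6) p.378 tl.16–21] -/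
theorem integral_wardN (lam : ℝ) {n : ℕ} (K : Fin (n + 1) → Finset (Fin 4 → ℤ)) (d : Fin (n + 1) → (Fin 4 → ℤ) → ℂ)
    (a m : Fin (n + 1) → Fin 3) (L : Finset (Fin 4 → ℤ)) (e : (Fin 4 → ℤ) → ℂ) (b : Fin 3) (ρ : ℕ) :
    ∫ A, wardN S lam K d a m L e b A ∂(T.law ρ) =
      (∑ i : Fin (n + 1),
          ((∑ t ∈ Fintype.piFinset fun _ : Fin n => modesOver S,
              (∏ k, coeffA K d a m i k (t k)) * (T.schwinger ρ n t : ℂ)) * deltaTerm (K i) (d i) L e (a i) b (m i) -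
            (lam : ℂ) * ∑ t ∈ Fintype.piFinset fun _ : Fin (n + 1) => modesOver S,
              (∏ j, coeffB K d a m L e b i j (t j)) * (T.schwinger ρ (n + 1) t : ℂ))) -
        ∑ t ∈ Fintype.piFinset fun _ : Fin (n + 2) => modesOver S,
          (∏ j, coeffC K d a m L e b j (t j)) * (T.schwinger ρ (n + 2) t : ℂ) := by
  have h : wardN S lam K d a m L e b = fun A =>
      (∑ i : Fin (n + 1),
          ((∏ k : Fin n, linC (modesOver S) (coeffA K d a m i k) A) * deltaTerm (K i) (d i) L e (a i) b (m i) -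
            (lam : ℂ) * ∏ j : Fin (n + 1), linC (modesOver S) (coeffB K d a m L e b i j) A)) -
        ∏ j : Fin (n + 2), linC (modesOver S) (coeffC K d a m L e b j) A :=
    funext fun A => wardN_eq S lam K d a m L e b A
  have hI : ∀ i : Fin (n + 1), Integrable (fun A =>
      (∏ k : Fin n, linC (modesOver S) (coeffA K d a m i k) A) * deltaTerm (K i) (d i) L e (a i) b (m i) -
        (lam : ℂ) * ∏ j : Fin (n + 1), linC (modesOver S) (coeffB K d a m L e b i j) A) (T.law ρ) := fun i =>
    ((T.integrable_prod_linC ρ _ _).mul_const _).sub ((T.integrable_prod_linC ρ _ _).const_mul _)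
  rw [h, integral_sub (integrable_finsetSum _ fun i _ => hI i) (T.integrable_prod_linC ρ _ _),
    integral_finsetSum _ fun i _ => hI i, T.integral_prod_linC]
  congr 1
  refine Finset.sum_congr rfl fun i _ => ?_
  rw [integral_sub ((T.integrable_prod_linC ρ _ _).mul_const _) ((T.integrable_prod_linC ρ _ _).const_mul _),
    integral_mul_const, integral_const_mul, T.integral_prod_linC, T.integral_prod_linC]

/-- **THE PRINTED LEFT-HAND SIDE OF (VIII.5)/(VIII.6) IS A FINITARY WARD EVALUATION**: for every cutoff `ρ`,
`finitaryWard (S_ρ) (wardDataN) = Re ∫ W_N d⟨·⟩_{ax,ρ}`. [cite: MagnenRivasseauSeneor1993, (VIII.5) p.377 tl.36–39, (VIII.6) p.378 tl.16–21] -/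
theorem finitaryWard_wardDataN (lam : ℝ) {n : ℕ} (K : Fin (n + 1) → Finset (Fin 4 → ℤ))
    (d : Fin (n + 1) → (Fin 4 → ℤ) → ℂ) (a m : Fin (n + 1) → Fin 3) (L : Finset (Fin 4 → ℤ)) (e : (Fin 4 → ℤ) → ℂ)
    (b : Fin 3) (ρ : ℕ) :
    finitaryWard (T.schwinger ρ) (wardDataN S lam K d a m L e b) =
      (∫ A, wardN S lam K d a m L e b A ∂(T.law ρ)).re := by
  rw [T.integral_wardN, wardDataN, finitaryWard_append, List.map_append, List.sum_append, sum_wardList,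
    sum_wardList, sum_wardList, Finset.sum_product, Finset.sum_product, zero_add, Complex.sub_re, Complex.re_sum]
  have eA : ∀ i : Fin (n + 1),
      ∑ t ∈ Fintype.piFinset (fun _ : Fin n => modesOver S),
          (deltaTerm (K i) (d i) L e (a i) b (m i) * ∏ k, coeffA K d a m i k (t k)).re * T.schwinger ρ n t =
        ((∑ t ∈ Fintype.piFinset (fun _ : Fin n => modesOver S),
            (∏ k, coeffA K d a m i k (t k)) * (T.schwinger ρ n t : ℂ)) * deltaTerm (K i) (d i) L e (a i) b (m i)).re :=
    fun i => by
    rw [Finset.sum_mul, Complex.re_sum]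
    refine Finset.sum_congr rfl fun t _ => ?_
    rw [← Complex.re_mul_ofReal]
    congr 1
    ring
  have eB : ∀ i : Fin (n + 1),
      ∑ t ∈ Fintype.piFinset (fun _ : Fin (n + 1) => modesOver S),
          (-(lam : ℂ) * ∏ j, coeffB K d a m L e b i j (t j)).re * T.schwinger ρ (n + 1) t =
        -((lam : ℂ) * ∑ t ∈ Fintype.piFinset (fun _ : Fin (n + 1) => modesOver S),
            (∏ j, coeffB K d a m L e b i j (t j)) * (T.schwinger ρ (n + 1) t : ℂ)).re := fun i => by
    rw [Finset.mul_sum, ← Complex.neg_re, ← Finset.sum_neg_distrib, Complex.re_sum]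
    refine Finset.sum_congr rfl fun t _ => ?_
    rw [← Complex.re_mul_ofReal]
    congr 1
    ring
  have eC : ∑ t ∈ Fintype.piFinset (fun _ : Fin (n + 2) => modesOver S),
        (-∏ j, coeffC K d a m L e b j (t j)).re * T.schwinger ρ (n + 2) t =
      -(∑ t ∈ Fintype.piFinset (fun _ : Fin (n + 2) => modesOver S),
          (∏ j, coeffC K d a m L e b j (t j)) * (T.schwinger ρ (n + 2) t : ℂ)).re := by
    rw [← Complex.neg_re, ← Finset.sum_neg_distrib, Complex.re_sum]
    refine Finset.sum_congr rfl fun t _ => ?_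
    rw [← Complex.re_mul_ofReal]
    congr 1
    ring
  simp_rw [eA, eB, eC, Complex.sub_re]
  rw [Finset.sum_neg_distrib, Finset.sum_sub_distrib]
  ring

/-- **(VIII.6) WITH THE PRINTED LEFT-HAND SIDE**: if the pinned theory's `N = n + 2`-source Ward datum at the test datum
`x` IS `wardDataN` (the print's), then under MRS's main statement `Re⟨W_N⟩_{ax,ρ} → E_N(x)` as `ρ → ∞` (p.378 tl.13–22).
`E_N` is NOT computed — «E_N can be computed for any given infrared cutoff» (p.378 tl.9) is not done in print.
[cite: MagnenRivasseauSeneor1993, (VIII.6) p.378 tl.2–22, p.327 tl.39–43] -/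
theorem tendsto_re_integral_wardN (h : T.PrintedStatement) (lam : ℝ) {n : ℕ} (K : Fin (n + 1) → Finset (Fin 4 → ℤ))
    (d : Fin (n + 1) → (Fin 4 → ℤ) → ℂ) (a m : Fin (n + 1) → Fin 3) (L : Finset (Fin 4 → ℤ)) (e : (Fin 4 → ℤ) → ℂ)
    (b : Fin 3) {x : T.WTest (n + 2)} (hx : T.wardData (n + 2) x = wardDataN S lam K d a m L e b) :
    Tendsto (fun ρ => (∫ A, wardN S lam K d a m L e b A ∂(T.law ρ)).re) atTop (𝓝 (T.E (n + 2) x)) := by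
  have hlim := tendsto_finitaryWard (G := fun ρ => T.schwinger ρ) (Glim := T.toAxialTheory.Slim)
    (fun n f => T.tendsto_schwinger_Slim h.1 n f) (T.wardData (n + 2) x)
  rw [T.slavnov_finitary h (n + 2) x] at hlim
  simp_rw [hx, T.finitaryWard_wardDataN] at hlim
  exact hlim

/-- (ae) in expectation: when every one-point function of the cut-off theory vanishes, `⟨W^{(VIII.5)}_{N=2}⟩_{ax,ρ} =
−⟨W^{(VIII.4)}⟩_{ax,ρ}` — the two displays then say the same thing. [cite: MagnenRivasseauSeneor1993, (VIII.4)–(VIII.5) p.377 tl.28–39, p.347 tl.19–22] -/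
theorem integral_wardN_zero_of_onePoint (lam : ℝ) (K : Finset (Fin 4 → ℤ)) (d : (Fin 4 → ℤ) → ℂ) (a m : Fin 3)
    (L : Finset (Fin 4 → ℤ)) (e : (Fin 4 → ℤ) → ℂ) (b : Fin 3) (ρ : ℕ) (h1 : ∀ t : Fin 1 → Mode, T.schwinger ρ 1 t = 0) :
    ∫ A, wardN S lam (n := 0) (fun _ => K) (fun _ => d) (fun _ => a) (fun _ => m) L e b A ∂(T.law ρ) =
      -∫ A, wardTwo S K d L e a b m A ∂(T.law ρ) := by
  have hE : ∀ c : Fin 3, ∫ A, ∫ y, trigPoly K d y * trigPoly L e y * field S A m.succ c y ∂vol ∂(T.law ρ) = 0 := by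
    intro c
    have hf : (fun A => ∫ y, trigPoly K d y * trigPoly L e y * field S A m.succ c y ∂vol) =
        fun A => linC (modesOver S) (pairCoeff (testWeight₂ K d L e) m.succ c) A :=
      funext fun A => by rw [smear₂_field_eq, linC_pairCoeff]
    rw [hf, T.integral_linC]
    exact Finset.sum_eq_zero fun md _ => by rw [h1]; simp
  have hEi : ∀ c : Fin 3, Integrable (fun A => ∫ y, trigPoly K d y * trigPoly L e y * field S A m.succ c y ∂vol)
      (T.law ρ) := by
    intro c
    have hf : (fun A => ∫ y, trigPoly K d y * trigPoly L e y * field S A m.succ c y ∂vol) =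
        linC (modesOver S) (pairCoeff (testWeight₂ K d L e) m.succ c) :=
      funext fun A => by rw [smear₂_field_eq, linC_pairCoeff]
    rw [hf]
    exact T.integrable_linC ρ _ _
  have hw : (fun A => wardN S lam (n := 0) (fun _ => K) (fun _ => d) (fun _ => a) (fun _ => m) L e b A) =
      fun A => -wardTwo S K d L e a b m A -
        (lam : ℂ) * ∑ c : Fin 3, (eps a c b : ℂ) * ∫ y, trigPoly K d y * trigPoly L e y * field S A m.succ c y ∂vol :=
    funext fun A => wardN_zero_eq S lam K d a m L e b A
  have hsum : Integrable (fun A => (lam : ℂ) * ∑ c : Fin 3, (eps a c b : ℂ) *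
      ∫ y, trigPoly K d y * trigPoly L e y * field S A m.succ c y ∂vol) (T.law ρ) :=
    (integrable_finsetSum _ fun c _ => (hEi c).const_mul _).const_mul _
  rw [hw, integral_sub (f := fun A => -wardTwo S K d L e a b m A) (T.integrable_wardTwo S K d L e a b m ρ).neg hsum,
    integral_neg, integral_const_mul, integral_finsetSum _ fun c _ => (hEi c).const_mul _]
  simp_rw [integral_const_mul, hE, mul_zero, Finset.sum_const_zero, mul_zero, sub_zero]

end PinnedTheory

namespace Slavnov

/-! ## §5 Reality: for REAL test functions and configurations obeying the reality constraint `Ã(−p) = conj Ã(p)` (the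
support of MRS's measures, `…PositionSpaceFields.ae_isRealOn_muZero`) the functionals `W₂`, `W_N` are REAL — the real
part taken in the Ward data loses nothing there -/

variable (S : Finset Momentum)

/-- A conjugation-invariant integrand has a conjugation-invariant integral (private plumbing). [folklore] -/
private theorem conj_integral_of_conj {F : Pos → ℂ} (h : ∀ x, conj (F x) = F x) : conj (∫ x, F x ∂vol) = ∫ x, F x ∂vol := by
  have h1 : ∫ x, conj (F x) ∂vol = conj (∫ x, F x ∂vol) := integral_conj
  rw [show (fun x => conj (F x)) = F from funext h] at h1
  exact h1.symm

/-- `A^a_μ(f) ∈ ℝ` for a real test function and a real cut-off field. [cite: MagnenRivasseauSeneor1993, (VIII.4) p.377 tl.32–35, §II.A p.328 tl.12–17] -/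
theorem conj_smear_field {A : Config} (hA : IsRealOn S A) {K : Finset (Fin 4 → ℤ)} {d : (Fin 4 → ℤ) → ℂ}
    (hd : RealCoeff K d) (μ : Fin 4) (a : Fin 3) :
    conj (∫ x, trigPoly K d x * field S A μ a x ∂vol) = ∫ x, trigPoly K d x * field S A μ a x ∂vol :=
  conj_integral_of_conj fun x => by rw [map_mul, conj_trigPoly hd, conj_field hA]

/-- `∫_Λ (∂₀²g) ∂_νA^a_μ ∈ ℝ` for a real test function and a real cut-off field. [cite: MagnenRivasseauSeneor1993, (VIII.4) p.377 tl.32–35] -/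
theorem conj_smear_d2_pderiv_field {A : Config} (hA : IsRealOn S A) {L : Finset (Fin 4 → ℤ)} {e : (Fin 4 → ℤ) → ℂ}
    (he : RealCoeff L e) (μ : Fin 4) (a : Fin 3) (ν : Fin 4) :
    conj (∫ y, pderiv 0 (pderiv 0 (trigPoly L e)) y * pderiv ν (field S A μ a) y ∂vol) =
      ∫ y, pderiv 0 (pderiv 0 (trigPoly L e)) y * pderiv ν (field S A μ a) y ∂vol :=
  conj_integral_of_conj fun y => by
    rw [map_mul, conj_pderiv_field hA, pderiv_pderiv_trigPoly, conj_trigPoly ((he.mul_I 0).mul_I 0)]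

/-- `∫_Λ f ∂_m g ∈ ℝ` for real test functions. [cite: MagnenRivasseauSeneor1993, (VIII.4) p.377 tl.32–35] -/
theorem conj_smear_pderiv_test {K : Finset (Fin 4 → ℤ)} {d : (Fin 4 → ℤ) → ℂ} (hd : RealCoeff K d)
    {L : Finset (Fin 4 → ℤ)} {e : (Fin 4 → ℤ) → ℂ} (he : RealCoeff L e) (ν : Fin 4) :
    conj (∫ y, trigPoly K d y * pderiv ν (trigPoly L e) y ∂vol) = ∫ y, trigPoly K d y * pderiv ν (trigPoly L e) y ∂vol :=
  conj_integral_of_conj fun y => by rw [map_mul, conj_trigPoly hd, pderiv_trigPoly, conj_trigPoly (he.mul_I ν)]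

/-- `∫_Λ f g A^c_μ ∈ ℝ` for real test functions and a real cut-off field. [cite: MagnenRivasseauSeneor1993, (VIII.5) p.377 tl.36–39] -/
theorem conj_smear₂_field {A : Config} (hA : IsRealOn S A) {K : Finset (Fin 4 → ℤ)} {d : (Fin 4 → ℤ) → ℂ}
    (hd : RealCoeff K d) {L : Finset (Fin 4 → ℤ)} {e : (Fin 4 → ℤ) → ℂ} (he : RealCoeff L e) (μ : Fin 4) (c : Fin 3) :
    conj (∫ y, trigPoly K d y * trigPoly L e y * field S A μ c y ∂vol) =
      ∫ y, trigPoly K d y * trigPoly L e y * field S A μ c y ∂vol :=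
  conj_integral_of_conj fun y => by rw [map_mul, map_mul, conj_trigPoly hd, conj_trigPoly he, conj_field hA]

/-- The δ-term is real for real test functions. [cite: MagnenRivasseauSeneor1993, (VIII.4) p.377 tl.32–35] -/
theorem conj_deltaTerm {K : Finset (Fin 4 → ℤ)} {d : (Fin 4 → ℤ) → ℂ} (hd : RealCoeff K d) {L : Finset (Fin 4 → ℤ)}
    {e : (Fin 4 → ℤ) → ℂ} (he : RealCoeff L e) (a b : Fin 3) (m : Fin 3) :
    conj (deltaTerm K d L e a b m) = deltaTerm K d L e a b m := by
  unfold deltaTerm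
  split_ifs
  · exact conj_smear_pderiv_test hd he m.succ
  · exact map_zero _

/-- **`W₂(A) ∈ ℝ`** for real test functions `f`, `g` and a configuration obeying the reality constraint: (VIII.4) is an
identity between REAL numbers on the support of MRS's measures; the real part in `wardDataTwo` is the number itself there.
[cite: MagnenRivasseauSeneor1993, (VIII.4) p.377 tl.28–35, §II.A p.328 tl.12–17] -/
theorem wardTwo_im_eq_zero {A : Config} (hA : IsRealOn S A) {K : Finset (Fin 4 → ℤ)} {d : (Fin 4 → ℤ) → ℂ}
    (hd : RealCoeff K d) {L : Finset (Fin 4 → ℤ)} {e : (Fin 4 → ℤ) → ℂ} (he : RealCoeff L e) (a b : Fin 3) (m : Fin 3) :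
    (wardTwo S K d L e a b m A).im = 0 := by
  apply Complex.conj_eq_iff_im.mp
  unfold wardTwo
  rw [map_sub, map_mul, map_sum, conj_smear_field S hA hd, conj_deltaTerm hd he]
  simp_rw [conj_smear_d2_pderiv_field S hA he]

/-- **`W_N(A) ∈ ℝ`** for real test functions and a configuration obeying the reality constraint (real `λ`, real `ε_abc`).
[cite: MagnenRivasseauSeneor1993, (VIII.5) p.377 tl.36–39, §II.A p.328 tl.12–17] -/
theorem wardN_im_eq_zero (lam : ℝ) {n : ℕ} {A : Config} (hA : IsRealOn S A) {K : Fin (n + 1) → Finset (Fin 4 → ℤ)}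
    {d : Fin (n + 1) → (Fin 4 → ℤ) → ℂ} (hd : ∀ j, RealCoeff (K j) (d j)) (a m : Fin (n + 1) → Fin 3)
    {L : Finset (Fin 4 → ℤ)} {e : (Fin 4 → ℤ) → ℂ} (he : RealCoeff L e) (b : Fin 3) :
    (wardN S lam K d a m L e b A).im = 0 := by
  apply Complex.conj_eq_iff_im.mp
  unfold wardN
  rw [map_sub, map_sum, map_mul, map_prod, map_sum]
  simp_rw [map_mul, map_sub, map_prod, map_mul, map_sum, map_mul, conj_ofReal, conj_smear_field S hA (hd _),
    conj_deltaTerm (hd _) he, conj_smear₂_field S hA (hd _) he, conj_smear_d2_pderiv_field S hA he]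

end Slavnov

/-! ## §6 (EDITION v1.1) THE PINNED CARRIER WITH THE PRINTED SLAVNOV DATA: Ward test data = the printed test functions and
indices, `wardData` = `wardDataN`; MRS's main statement for such a theory UNFOLDS to «UV limit exists ∧ for all printed
test data Re⟨W_N⟩_{ax,ρ} → E_N» -/

namespace Slavnov

variable (S : Finset Momentum)

/-- **THE PRINTED WARD TEST DATUM for `N = n + 2` sources** ((VIII.5)/(VIII.6) «applied to test functions»): the `N − 1 =
n + 1` field points `x_j` carry cut-off test functions `f_j = trigPoly (K j) (d j)`, colours `a_j` and spatial indices
`m_j`; the point `y` carries `g = trigPoly L e` and the colour `b`. [cite: MagnenRivasseauSeneor1993, (VIII.5) p.377 tl.36–39, (VIII.4) p.377 tl.34–35, (VIII.6) p.378 tl.5–8] -/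
structure TestDatum (n : ℕ) where
  /-- frequency sets of the test functions `f_j` -/
  K : Fin (n + 1) → Finset (Fin 4 → ℤ)
  /-- Fourier coefficients of the test functions `f_j` -/
  d : Fin (n + 1) → (Fin 4 → ℤ) → ℂ
  /-- colour indices `a_j` -/
  a : Fin (n + 1) → Fin 3
  /-- spatial indices `m_j` -/
  m : Fin (n + 1) → Fin 3
  /-- frequency set of the test function `g` of `y` -/
  L : Finset (Fin 4 → ℤ)
  /-- Fourier coefficients of `g` -/
  e : (Fin 4 → ℤ) → ℂ
  /-- the colour index `b` -/
  b : Fin 3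

/-- **THE PRINTED WARD TEST DATA, per number of sources `N`**: none for `N < 2` (the displays (VIII.4)–(VIII.6) have
`N − 1 ≥ 1` field points — READING (N)), `TestDatum n` for `N = n + 2`. [cite: MagnenRivasseauSeneor1993, (VIII.5) p.377 tl.36–39, (VIII.6) p.378 tl.5–8] -/
def WTestPrinted : ℕ → Type
  | 0 => PEmpty
  | 1 => PEmpty
  | n + 2 => TestDatum n

/-- The functional `W_N` of a printed test datum. [cite: MagnenRivasseauSeneor1993, (VIII.5) p.377 tl.36–39] -/
def TestDatum.W (lam : ℝ) {n : ℕ} (x : TestDatum n) : Config → ℂ := wardN S lam x.K x.d x.a x.m x.L x.e x.b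

/-- The Ward datum of a printed test datum. [cite: MagnenRivasseauSeneor1993, (VIII.6) p.378 tl.5–8, tl.20–21] -/
def TestDatum.data (lam : ℝ) {n : ℕ} (x : TestDatum n) : WardData := wardDataN S lam x.K x.d x.a x.m x.L x.e x.b

/-- **THE PRINTED `wardData` FAMILY** — the instance of (K4)'s free field that the print fixes (under READINGS (P), (R1),
(m), (λ), (T)): at `N = n + 2` sources the datum `wardDataN` of the printed test datum; nothing at `N < 2`.
[cite: MagnenRivasseauSeneor1993, (VIII.5) p.377 tl.36–39, (VIII.6) p.378 tl.5–8, tl.20–21] -/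
def wardDataPrinted (lam : ℝ) : (N : ℕ) → WTestPrinted N → WardData
  | 0, x => PEmpty.elim x
  | 1, x => PEmpty.elim x
  | _ + 2, x => TestDatum.data S lam x

end Slavnov

namespace PinnedTheory

open Slavnov

variable (T : PinnedTheory) (S : Finset Momentum)

/-- **A PINNED THEORY WITH THE PRINTED SLAVNOV DATA**: same parameters, laws `⟨·⟩_{ax,ρ}` and axial gauge as `T`; Ward
test data := the printed test data `WTestPrinted`, `wardData` := `wardDataPrinted` (the displays (VIII.5)/(VIII.6) applied
to test functions, as finitary functionals of the Schwinger functions), infrared correction `E` given on the printed test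
data (no formula for `E_N` is printed — it stays a datum). [cite: MagnenRivasseauSeneor1993, p.327 tl.39–43, (VIII.6) p.378 tl.2–22] -/
def withPrintedSlavnov (lam : ℝ) (E : (N : ℕ) → WTestPrinted N → ℝ) : PinnedTheory where
  par := T.par
  law := T.law
  isProb := T.isProb
  integrable := T.integrable
  axial := T.axial
  WTest := WTestPrinted
  wardData := wardDataPrinted S lam
  E := E

/-- Same Schwinger functions. [cite: MagnenRivasseauSeneor1993, p.378 tl.17–21] -/
@[simp] theorem withPrintedSlavnov_schwinger (lam : ℝ) (E : (N : ℕ) → WTestPrinted N → ℝ) :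
    (T.withPrintedSlavnov S lam E).schwinger = T.schwinger := rfl

/-- Same laws. [cite: MagnenRivasseauSeneor1993, p.378 tl.17] -/
@[simp] theorem withPrintedSlavnov_law (lam : ℝ) (E : (N : ℕ) → WTestPrinted N → ℝ) :
    (T.withPrintedSlavnov S lam E).law = T.law := rfl

/-- Same first conjunct: the ultraviolet limit of the Schwinger functions exists for the one iff for the other.
[cite: MagnenRivasseauSeneor1993, p.327 tl.39–41] -/
theorem uvLimit_withPrintedSlavnov_iff (lam : ℝ) (E : (N : ℕ) → WTestPrinted N → ℝ) :
    UVLimitExistsPrinted (T.withPrintedSlavnov S lam E).toAxialTheory ↔ UVLimitExistsPrinted T.toAxialTheory :=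
  Iff.rfl

/-- The carrier so built presents the interface `IsMRSTheory` with the same printed parameters.
[cite: MagnenRivasseauSeneor1993, p.327 tl.39–43] -/
theorem isMRSTheory_withPrintedSlavnov (lam : ℝ) (E : (N : ℕ) → WTestPrinted N → ℝ) :
    (T.withPrintedSlavnov S lam E).toAxialTheory.IsMRSTheory T.par :=
  ⟨T.withPrintedSlavnov S lam E, rfl, rfl⟩

/-- **MRS'S MAIN STATEMENT WITH THE PRINTED SLAVNOV LEFT-HAND SIDE, UNFOLDED** (p.327 tl.39–43 with (VIII.6) p.378 and
«The identities (VIII.6) are those that we are going to check in the limit ρ → ∞ … the left-hand side, made of normalized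
Schwinger functions with cutoff ρ, by definition tends to the same Schwinger functions without ultraviolet cutoff»
p.378 tl.13–22): for the pinned theory carrying the printed Ward data, `PrintedStatement` HOLDS IFF the ultraviolet limit
of every Schwinger function exists AND, for every number of sources `N = n + 2` and every printed test datum `x`
(test functions `f_1 … f_{N−1}`, `g`, colours, spatial indices), `Re⟨W_N(x)⟩_{ax,ρ} → E_N(x)` as `ρ → ∞`, with `W_N`
the position-space functional `Slavnov.wardN` of (VIII.5). The second conjunct of the main statement is thereby
expressed through the printed displays and the laws `⟨·⟩_{ax,ρ}` alone; `E_N` remains a datum (no printed formula).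
A typed unfolding of a HYPOTHESIS — nothing of it is proved. [cite: MagnenRivasseauSeneor1993, p.327 tl.39–43, (VIII.5) p.377 tl.36–39, (VIII.6) p.378 tl.2–22] -/
theorem printedStatement_withPrintedSlavnov_iff (lam : ℝ) (E : (N : ℕ) → WTestPrinted N → ℝ) :
    (T.withPrintedSlavnov S lam E).PrintedStatement ↔
      UVLimitExistsPrinted T.toAxialTheory ∧
        ∀ (n : ℕ) (x : TestDatum n),
          Tendsto (fun ρ => (∫ A, x.W S lam A ∂(T.law ρ)).re) atTop (𝓝 (E (n + 2) x)) := by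
  constructor
  · intro h
    refine ⟨h.1, fun n x => ?_⟩
    exact (T.withPrintedSlavnov S lam E).tendsto_re_integral_wardN S h lam x.K x.d x.a x.m x.L x.e x.b
      (x := (x : (T.withPrintedSlavnov S lam E).WTest (n + 2))) rfl
  · rintro ⟨huv, hW⟩
    refine ⟨huv, fun N x => ?_⟩
    match N, x with
    | 0, x => exact PEmpty.elim x
    | 1, x => exact PEmpty.elim x
    | n + 2, x =>
      have hlim := tendsto_finitaryWard (G := fun ρ => T.schwinger ρ)
        (Glim := (T.withPrintedSlavnov S lam E).toAxialTheory.Slim)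
        (fun k f => (T.withPrintedSlavnov S lam E).tendsto_schwinger_Slim huv k f)
        ((T.withPrintedSlavnov S lam E).wardData (n + 2) x)
      have hre : (fun ρ => finitaryWard (T.schwinger ρ) ((T.withPrintedSlavnov S lam E).wardData (n + 2) x)) =
          fun ρ => (∫ A, x.W S lam A ∂(T.law ρ)).re :=
        funext fun ρ => T.finitaryWard_wardDataN S lam x.K x.d x.a x.m x.L x.e x.b ρ
      rw [hre] at hlim
      exact tendsto_nhds_unique hlim (hW n x)

/-- The formal hierarchy (VIII.5) (`E ≡ 0`) in the same terms: `PrintedStatement` with zero infrared correction iff the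
ultraviolet limit exists and every `Re⟨W_N(x)⟩_{ax,ρ} → 0`. [cite: MagnenRivasseauSeneor1993, (VIII.5) p.377 tl.36–39, (VIII.6) p.378 tl.9–12] -/
theorem printedStatement_withPrintedSlavnov_formal_iff (lam : ℝ) :
    (T.withPrintedSlavnov S lam fun _ _ => 0).PrintedStatement ↔
      UVLimitExistsPrinted T.toAxialTheory ∧
        ∀ (n : ℕ) (x : TestDatum n), Tendsto (fun ρ => (∫ A, x.W S lam A ∂(T.law ρ)).re) atTop (𝓝 0) :=
  T.printedStatement_withPrintedSlavnov_iff S lam fun _ _ => 0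

end PinnedTheory

/-! ## §7 (EDITION v1.1) READING (T) AS A THEOREM: an ARBITRARY integrable test function on `Λ` acts on the cut-off
field only through its window coefficients `∫_Λ f e^{ip·x}`, `p ∈ S` — restricting to trigonometric-polynomial test
functions loses nothing -/

namespace Slavnov

variable (S : Finset Momentum)

/-- The window coefficient `∫_Λ f(x) e^{ip·x} d⁴x` of an ARBITRARY test function `f` on `Λ` at the mode `p`.
[cite: MagnenRivasseauSeneor1993, (VIII.4) p.377 tl.34–35, §II.A p.328 tl.12–15] -/
def testWeightL (f : Pos → ℂ) (p : Momentum) : ℂ := ∫ x, f x * chi p.1 x ∂vol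

/-- `f·e^{ik·x}` is integrable for integrable `f` (characters are continuous of modulus one).
[cite: MagnenRivasseauSeneor1993, §II.A p.328 tl.12–15] -/
theorem integrable_mul_chi {f : Pos → ℂ} (hf : Integrable f vol) (k : Fin 4 → ℤ) :
    Integrable (fun x => f x * chi k x) vol := by
  refine Integrable.mul_bdd hf (continuous_chi k).aestronglyMeasurable (c := 1) ?_
  exact Filter.Eventually.of_forall fun x => by rw [norm_chi]

/-- **READING (T) IS HARMLESS**: ANY integrable test function `f` on `Λ` smears the cut-off field through its window
coefficients only — `∫_Λ f A^a_μ = Σ_{p∈S} (∫_Λ f e^{ip·x}) Ã^a_μ(p)`; «applied to two test functions of x and y» with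
general test functions is therefore the same finitary functional as with their trigonometric-polynomial truncations to
the window. [cite: MagnenRivasseauSeneor1993, (VIII.4) p.377 tl.34–35, §II.A p.328 tl.12–17] -/
theorem smear_field_eq_general {f : Pos → ℂ} (hf : Integrable f vol) (μ : Fin 4) (a : Fin 3) (A : Config) :
    ∫ x, f x * field S A μ a x ∂vol = pairW S (testWeightL f) μ a A := by
  unfold field pairW testWeightL
  have h : ∀ x, f x * ∑ p ∈ S, coeff A p μ a * chi p.1 x = ∑ p ∈ S, coeff A p μ a * (f x * chi p.1 x) := by
    intro x
    rw [Finset.mul_sum]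
    exact Finset.sum_congr rfl fun p _ => by ring
  simp_rw [h]
  rw [integral_finsetSum _ fun p _ => (integrable_mul_chi hf p.1).const_mul _]
  refine Finset.sum_congr rfl fun p _ => ?_
  rw [integral_const_mul]
  ring

/-- Consistency with §2: for a trigonometric-polynomial test function the window coefficient IS `d_{−p}`
(`testWeightL (trigPoly K d) p = testWeight K d p`). [cite: MagnenRivasseauSeneor1993, §II.A p.328 tl.12–15] -/
theorem testWeightL_trigPoly (K : Finset (Fin 4 → ℤ)) (d : (Fin 4 → ℤ) → ℂ) (p : Momentum) :
    testWeightL (trigPoly K d) p = testWeight K d p := by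
  unfold testWeightL
  have h := integral_trigPoly_mul_sum_chi {p} K d fun _ => 1
  simp only [Finset.sum_singleton, one_mul, mul_one] at h
  exact h

end Slavnov

/-! ## §8 (EDITION v1.2) the Sect. VIII reduction p.378 tl.13–25 WITH THE PRINTED LEFT-HAND SIDE: the «approximate identities» ⟨W_N⟩_{ax,ρ} = E_N + δ_N(ρ) for the theory carrying the printed Slavnov data, and the
main statement from «UV limit ∧ approximate identities ∧ δ_N(ρ) → 0» -/

namespace PinnedTheory

open Slavnov

variable (T : PinnedTheory) (S : Finset Momentum)

/-- **THE APPROXIMATE IDENTITIES (p.378 tl.14–20) WITH THE PRINTED LEFT-HAND SIDE, UNFOLDED**: for the pinned theory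
carrying the printed Ward data, `ApproximateSlavnovPrinted` with error terms `δ` HOLDS IFF for every `N = n + 2`, every
printed test datum `x` and every cutoff `ρ`, `Re⟨W_N(x)⟩_{ax,ρ} = E_N(x) + δ_N(x)(ρ)` — «equality between the left-hand side
of (VIII.6) where ⟨·⟩_ax is replaced by ⟨·⟩_{ax,ρ} … and a right-hand side which is no longer E_N, but E_N + δ_N(ρ)». A typed
unfolding; neither E_N nor δ_N(ρ) is computed. [cite: MagnenRivasseauSeneor1993, p.378 tl.14–20, (VIII.5) p.377 tl.36–39] -/
theorem approximateSlavnov_withPrintedSlavnov_iff (lam : ℝ) (E : (N : ℕ) → WTestPrinted N → ℝ)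
    (δ : (N : ℕ) → WTestPrinted N → ℕ → ℝ) :
    ApproximateSlavnovPrinted (T.withPrintedSlavnov S lam E).toAxialTheory δ ↔
      ∀ (n : ℕ) (x : TestDatum n) (ρ : ℕ),
        (∫ A, x.W S lam A ∂(T.law ρ)).re = E (n + 2) x + δ (n + 2) x ρ := by
  constructor
  · intro h n x ρ
    have hx := h (n + 2) x ρ
    unfold TestDatum.W
    rw [← T.finitaryWard_wardDataN S lam x.K x.d x.a x.m x.L x.e x.b ρ]
    exact hx
  · intro h N x ρ
    match N, x with
    | 0, x => exact PEmpty.elim x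
    | 1, x => exact PEmpty.elim x
    | n + 2, x =>
      have hx := h n x ρ
      unfold TestDatum.W at hx
      show finitaryWard (T.schwinger ρ) (wardDataN S lam x.K x.d x.a x.m x.L x.e x.b) = E (n + 2) x + δ (n + 2) x ρ
      rw [T.finitaryWard_wardDataN S lam x.K x.d x.a x.m x.L x.e x.b ρ]
      exact hx

/-- **THE SECT. VIII REDUCTION WITH THE PRINTED LEFT-HAND SIDE** (p.378 tl.13–25, the logical content of «This achieves our
sketch of proof of the main statement»): if the ultraviolet limit of every Schwinger function exists, the approximate
identities `Re⟨W_N(x)⟩_{ax,ρ} = E_N(x) + δ_N(x)(ρ)` hold for all printed test data, and every `δ_N(x)(ρ) → 0`, then MRS's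
main statement holds for the theory carrying the printed Slavnov data. The three hypotheses ARE the analytic content of
the paper (a self-declared sketch); nothing of them is proved here. [cite: MagnenRivasseauSeneor1993, p.378 tl.13–25, p.327 tl.39–43] -/
theorem printedStatement_withPrintedSlavnov_of_sectVIII (lam : ℝ) (E : (N : ℕ) → WTestPrinted N → ℝ)
    (δ : (N : ℕ) → WTestPrinted N → ℕ → ℝ) (huv : UVLimitExistsPrinted T.toAxialTheory)
    (happrox : ∀ (n : ℕ) (x : TestDatum n) (ρ : ℕ), (∫ A, x.W S lam A ∂(T.law ρ)).re = E (n + 2) x + δ (n + 2) x ρ)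
    (hδ : ∀ (n : ℕ) (x : TestDatum n), Tendsto (δ (n + 2) x) atTop (𝓝 0)) :
    (T.withPrintedSlavnov S lam E).PrintedStatement := by
  refine (T.withPrintedSlavnov S lam E).mainStatement_of_sectVIII δ
    ((T.uvLimit_withPrintedSlavnov_iff S lam E).mpr huv)
    ((T.approximateSlavnov_withPrintedSlavnov_iff S lam E δ).mpr happrox) ?_
  intro N x
  match N, x with
  | 0, x => exact PEmpty.elim x
  | 1, x => exact PEmpty.elim x
  | n + 2, x => exact hδ n x

end PinnedTheory

/-! ## §9 (EDITION v1.3) THE VACUITY FRONTIER OF `…MRS93MainStatementPinned` WITH THE PRINTED LEFT-HAND SIDE (honest,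
PROVED): at the zero configuration `W₂ = −δ_{ab}∫_Λ f∂_m g`, `W_N = δ-terms` (`N = 2` in the (VIII.5) form) and `W_N = 0`
(`N ≥ 3`); the zero-field carrier `diracModel` equipped with the printed Slavnov data satisfies MRS's statement IFF
`E_N(x) = Re W_N(x)(0)` — so the FORMAL identities (VIII.4)/(VIII.5) (`E ≡ 0`) now EXCLUDE it, and so does the recipe
«`E :=` constant term» of `…MRS93MainStatementPinned`, while with `E₂ := Re(δ-term)`, `E_N := 0` (`N ≥ 3`) it survives:
the frontier is exactly «`E_N` is not printed» -/

namespace Slavnov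

variable (S : Finset Momentum)

/-- A linear form vanishes at the zero configuration. [cite: MagnenRivasseauSeneor1993, (VIII.1) p.377] -/
theorem linC_zero_config (M : Finset Mode) (c : Mode → ℂ) : linC M c 0 = 0 := by
  unfold linC
  exact Finset.sum_eq_zero fun m _ => by simp

/-- A product of `n + 1` linear forms vanishes at the zero configuration. [cite: MagnenRivasseauSeneor1993, (VIII.1) p.377] -/
theorem prod_linC_zero_config {n : ℕ} (M : Fin (n + 1) → Finset Mode) (c : Fin (n + 1) → Mode → ℂ) :
    ∏ j, linC (M j) (c j) (0 : Config) = 0 :=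
  Finset.prod_eq_zero (Finset.mem_univ 0) (linC_zero_config (M 0) (c 0))

/-- **(VIII.4) AT THE ZERO FIELD**: `W₂(0) = −δ_{ab}∫_Λ f∂_m g` — only the δ-term survives when the field is switched off.
[cite: MagnenRivasseauSeneor1993, (VIII.4) p.377 tl.28–35] -/
theorem wardTwo_zero_config (K : Finset (Fin 4 → ℤ)) (d : (Fin 4 → ℤ) → ℂ) (L : Finset (Fin 4 → ℤ)) (e : (Fin 4 → ℤ) → ℂ)
    (a b : Fin 3) (m : Fin 3) : wardTwo S K d L e a b m 0 = -deltaTerm K d L e a b m := by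
  rw [wardTwo_eq, prod_linC_zero_config, zero_sub]

/-- **(VIII.5) AT THE ZERO FIELD, `N ≥ 3`**: every term of `W_N` carries at least one field factor, so `W_N(0) = 0`.
[cite: MagnenRivasseauSeneor1993, (VIII.5) p.377 tl.36–39] -/
theorem wardN_zero_config_succ (lam : ℝ) {n : ℕ} (K : Fin (n + 2) → Finset (Fin 4 → ℤ))
    (d : Fin (n + 2) → (Fin 4 → ℤ) → ℂ) (a m : Fin (n + 2) → Fin 3) (L : Finset (Fin 4 → ℤ)) (e : (Fin 4 → ℤ) → ℂ)
    (b : Fin 3) : wardN S lam K d a m L e b 0 = 0 := by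
  rw [wardN_eq]
  simp_rw [prod_linC_zero_config]
  simp

/-- **(VIII.5) AT THE ZERO FIELD, `N = 2`**: `W_2^{(VIII.5)}(0) = δ_{ab}∫_Λ f∂_m g` (the δ-term; cf. `wardN_zero_eq`).
[cite: MagnenRivasseauSeneor1993, (VIII.5) p.377 tl.36–39, (VIII.4) p.377 tl.32–35] -/
theorem wardN_zero_config_zero (lam : ℝ) (K : Fin 1 → Finset (Fin 4 → ℤ)) (d : Fin 1 → (Fin 4 → ℤ) → ℂ)
    (a m : Fin 1 → Fin 3) (L : Finset (Fin 4 → ℤ)) (e : (Fin 4 → ℤ) → ℂ) (b : Fin 3) :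
    wardN S lam K d a m L e b 0 = deltaTerm (K 0) (d 0) L e (a 0) b (m 0) := by
  rw [wardN_eq]
  simp_rw [prod_linC_zero_config]
  simp

/-- The value `Re W_N(x)(0)` of the printed functional of a test datum at the zero field, as an infrared-correction datum
on the printed test data: `Re(δ_{ab}∫_Λ f∂_m g)` at `N = 2`, `0` at `N ≥ 3` (`ezero_two`, `ezero_succ`). NOT MRS's `E_N`
(no formula is printed) — the datum that lets the zero-field carrier pass, exhibited for honesty.
[cite: MagnenRivasseauSeneor1993, (VIII.6) p.378 tl.5–12] -/
def ezero (lam : ℝ) : (N : ℕ) → WTestPrinted N → ℝ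
  | 0, x => PEmpty.elim x
  | 1, x => PEmpty.elim x
  | _ + 2, x => (TestDatum.W S lam x 0).re

/-- `ezero` at `N = 2` is the real part of the δ-term. [cite: MagnenRivasseauSeneor1993, (VIII.4) p.377 tl.32–35] -/
theorem ezero_two (lam : ℝ) (x : TestDatum 0) :
    ezero S lam 2 x = (deltaTerm (x.K 0) (x.d 0) x.L x.e (x.a 0) x.b (x.m 0)).re := by
  show (TestDatum.W S lam x 0).re = _
  rw [TestDatum.W, wardN_zero_config_zero]

/-- `ezero` vanishes for `N ≥ 3`. [cite: MagnenRivasseauSeneor1993, (VIII.5) p.377 tl.36–39] -/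
theorem ezero_succ (lam : ℝ) {n : ℕ} (x : TestDatum (n + 1)) : ezero S lam (n + 3) x = 0 := by
  show (TestDatum.W S lam x 0).re = _
  rw [TestDatum.W, wardN_zero_config_succ, Complex.zero_re]

/-- The spatial unit frequency `e_{m}` (`m ∈ {1,2,3}`) of the dual lattice. [cite: MagnenRivasseauSeneor1993, §II.A p.328 tl.12–15] -/
def unitFreq (m : Fin 3) : Fin 4 → ℤ := Pi.single m.succ 1

/-- **A PRINTED TEST DATUM WITH NON-ZERO δ-TERM**: one field point with `f = e^{−ie_m·x}`, the point `y` with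
`g = −i e^{ie_m·x}`, equal colours `a = b`, spatial index `m`; then `δ_{ab}∫_Λ f∂_m g = 1`. [cite: MagnenRivasseauSeneor1993, (VIII.4) p.377 tl.32–35] -/
def witnessDatum (a m : Fin 3) : TestDatum 0 where
  K := fun _ => {-unitFreq m}
  d := fun _ _ => 1
  a := fun _ => a
  m := fun _ => m
  L := {unitFreq m}
  e := fun _ => -I
  b := a

/-- The δ-term of the witness datum is `1`. [cite: MagnenRivasseauSeneor1993, (VIII.4) p.377 tl.32–35, §II.A p.328 tl.12–13] -/
theorem deltaTerm_witness (a m : Fin 3) :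
    deltaTerm {-unitFreq m} (fun _ => 1) {unitFreq m} (fun _ => -I) a a m = 1 := by
  unfold deltaTerm
  rw [if_pos rfl]
  have h : ∀ y, trigPoly {-unitFreq m} (fun _ => 1) y * pderiv m.succ (trigPoly {unitFreq m} (fun _ => -I)) y = chi 0 y := by
    intro y
    rw [pderiv_trigPoly, trigPoly_mul_trigPoly]
    simp [unitFreq, neg_add_cancel]
  simp_rw [h]
  rw [integral_chi, if_pos rfl]

/-- … hence the printed functional of the witness datum is `1` at the zero field. [cite: MagnenRivasseauSeneor1993, (VIII.5) p.377 tl.36–39] -/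
theorem witnessDatum_W_zero (lam : ℝ) (a m : Fin 3) : (witnessDatum a m).W S lam 0 = 1 := by
  rw [TestDatum.W, wardN_zero_config_zero]
  exact deltaTerm_witness a m

end Slavnov

/-! ### The zero-field carrier against the printed left-hand side -/

section ZeroFieldFrontier

open Slavnov

/-- The ultraviolet limit trivially exists for the zero-field carrier (constant sequences).
[cite: MagnenRivasseauSeneor1993, p.327 tl.39–41] -/
theorem diracModel_uvLimit (par : Parameters) (WTest : ℕ → Type) (wardData : (N : ℕ) → WTest N → WardData) :
    UVLimitExistsPrinted (diracModel par WTest wardData).toAxialTheory := by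
  intro N f
  refine ⟨monomial f 0, ?_⟩
  simp only [PinnedTheory.toAxialTheory_S, diracModel_schwinger]
  exact tendsto_const_nhds

/-- Expectations in the zero-field carrier are evaluations at the zero configuration. [cite: MagnenRivasseauSeneor1993, p.327 tl.39–43] -/
theorem diracModel_integral (par : Parameters) (WTest : ℕ → Type) (wardData : (N : ℕ) → WTest N → WardData)
    (ρ : ℕ) (F : Config → ℂ) : ∫ A, F A ∂((diracModel par WTest wardData).law ρ) = F 0 := by
  show ∫ A, F A ∂(Measure.dirac 0) = F 0
  exact integral_dirac F 0

/-- **THE FRONTIER, LOCATED**: the zero-field carrier equipped with the printed Slavnov data and an infrared-correction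
datum `E` satisfies MRS's main statement IFF `E_N(x) = Re W_N(x)(0)` for every printed test datum — i.e. iff `E` is
`ezero` (`Re(δ-term)` at `N = 2`, `0` at `N ≥ 3`). [cite: MagnenRivasseauSeneor1993, p.327 tl.39–43, (VIII.6) p.378 tl.5–22] -/
theorem diracModel_withPrintedSlavnov_printedStatement_iff (par : Parameters) (WTest : ℕ → Type)
    (wardData : (N : ℕ) → WTest N → WardData) (S : Finset Momentum) (lam : ℝ) (E : (N : ℕ) → WTestPrinted N → ℝ) :
    ((diracModel par WTest wardData).withPrintedSlavnov S lam E).PrintedStatement ↔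
      ∀ (n : ℕ) (x : TestDatum n), E (n + 2) x = (x.W S lam 0).re := by
  rw [PinnedTheory.printedStatement_withPrintedSlavnov_iff]
  simp_rw [diracModel_integral]
  constructor
  · rintro ⟨-, h⟩ n x
    exact (tendsto_const_nhds_iff.mp (h n x)).symm
  · intro h
    refine ⟨diracModel_uvLimit par WTest wardData, fun n x => ?_⟩
    rw [h n x]
    exact tendsto_const_nhds

/-- **IT SURVIVES with `E := ezero`** — MRS's statement WITH the printed left-hand side still has the zero-field model,
because `E_N` «can be computed for any given infrared cutoff» (p.378 tl.9) but is not printed: nothing typed pins it.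
[cite: MagnenRivasseauSeneor1993, p.327 tl.39–48, (VIII.6) p.378 tl.5–12] -/
theorem diracModel_withPrintedSlavnov_ezero_printedStatement (par : Parameters) (WTest : ℕ → Type)
    (wardData : (N : ℕ) → WTest N → WardData) (S : Finset Momentum) (lam : ℝ) :
    ((diracModel par WTest wardData).withPrintedSlavnov S lam (ezero S lam)).PrintedStatement :=
  (diracModel_withPrintedSlavnov_printedStatement_iff par WTest wardData S lam (ezero S lam)).mpr fun _ _ => rfl

/-- Hence, for EVERY choice of the named printed parameters, SOME pinned theory carrying the printed Slavnov data satisfies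
MRS's main statement — the analogue of `exists_isMRSTheory_mainStatementPrinted` of `…MRS93MainStatementPinned` after (K4)
is instantiated: typing the printed left-hand side does not by itself give the statement content beyond the formal
hierarchy; the infrared correction `E_N` would. [cite: MagnenRivasseauSeneor1993, p.327 tl.39–48, (VIII.6) p.378 tl.5–12] -/
theorem exists_withPrintedSlavnov_printedStatement (par : Parameters) (S : Finset Momentum) (lam : ℝ) :
    ∃ (T : PinnedTheory) (E : (N : ℕ) → WTestPrinted N → ℝ), T.par = par ∧ (T.withPrintedSlavnov S lam E).PrintedStatement :=
  ⟨diracModel par WTestPrinted (wardDataPrinted S lam), ezero S lam, rfl,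
    diracModel_withPrintedSlavnov_ezero_printedStatement par _ _ S lam⟩

/-- **THE FORMAL IDENTITIES (VIII.4)/(VIII.5) EXCLUDE THE ZERO FIELD**: with `E ≡ 0` the zero-field carrier FAILS the
printed statement (the witness datum has `Re W₂^{(VIII.5)}(0) = 1 ≠ 0`) — once (K4) is instantiated by the print, the
formal Slavnov hierarchy is NOT vacuous on the pinned carrier. [cite: MagnenRivasseauSeneor1993, (VIII.4)–(VIII.5) p.377 tl.28–39] -/
theorem not_printedStatement_diracModel_withPrintedSlavnov_formal (par : Parameters) (WTest : ℕ → Type)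
    (wardData : (N : ℕ) → WTest N → WardData) (S : Finset Momentum) (lam : ℝ) :
    ¬ ((diracModel par WTest wardData).withPrintedSlavnov S lam fun _ _ => 0).PrintedStatement := by
  rw [diracModel_withPrintedSlavnov_printedStatement_iff]
  intro h
  have h1 := h 0 (witnessDatum 0 0)
  rw [witnessDatum_W_zero, Complex.one_re] at h1
  exact zero_ne_one h1

/-- The zero-field carrier OF `…MRS93MainStatementPinned` with the printed Slavnov data plugged into its own slots
(`WTest := WTestPrinted`, `wardData := wardDataPrinted`, hence `E_N :=` the constant term of `wardDataN`, which is `0`)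
IS the printed-Slavnov carrier with `E ≡ 0`. [cite: MagnenRivasseauSeneor1993, p.327 tl.39–43, (VIII.6) p.378 tl.5–8] -/
theorem diracModel_printed_eq (par : Parameters) (S : Finset Momentum) (lam : ℝ) :
    diracModel par WTestPrinted (wardDataPrinted S lam) =
      (diracModel par WTestPrinted (wardDataPrinted S lam)).withPrintedSlavnov S lam fun _ _ => 0 := by
  have hE : (fun (N : ℕ) (x : WTestPrinted N) => (wardDataPrinted S lam N x).1) = fun _ _ => (0 : ℝ) := by
    funext N x
    match N, x with
    | 0, x => exact PEmpty.elim x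
    | 1, x => exact PEmpty.elim x
    | n + 2, x => rfl
  show diracModel par WTestPrinted (wardDataPrinted S lam) =
    { par := par, law := fun _ => Measure.dirac 0, isProb := _, integrable := _, axial := _,
      WTest := WTestPrinted, wardData := wardDataPrinted S lam, E := fun _ _ => 0 }
  unfold diracModel
  congr 1

/-- **… AND THAT CARRIER FAILS MRS'S STATEMENT**: the recipe «`E_N :=` constant term of the Ward functional» by which
`diracModel_mainStatement` passed (its hypothesis «every listed term has arity ≥ 1» is violated by the printed data: the
δ-term of (VIII.4) multiplies the ZERO-point function) does not survive the printed left-hand side.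
[cite: MagnenRivasseauSeneor1993, p.327 tl.39–48, (VIII.4)–(VIII.6) p.377–378] -/
theorem not_printedStatement_diracModel_printed (par : Parameters) (S : Finset Momentum) (lam : ℝ) :
    ¬ (diracModel par WTestPrinted (wardDataPrinted S lam)).PrintedStatement := by
  rw [diracModel_printed_eq]
  exact not_printedStatement_diracModel_withPrintedSlavnov_formal par WTestPrinted (wardDataPrinted S lam) S lam

end ZeroFieldFrontier

/-! ## §10 (EDITION v1.4) THE SLAVNOV CONJUNCT IS DEFINITIONAL WHILE `E_N` IS A FREE DATUM: for every pinned theory whose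
ultraviolet limit exists, `E :=` the limit of the printed left-hand side makes MRS's statement hold; hence
`UVLimitExistsPrinted T ↔ ∃ E, (T.withPrintedSlavnov S λ E).PrintedStatement` -/

namespace PinnedTheory

open Slavnov

variable (T : PinnedTheory) (S : Finset Momentum)

/-- The limit of the printed left-hand side, as an infrared datum: `E_N(x) := W[S_∞](wardDataN x)`.
[cite: MagnenRivasseauSeneor1993, (VIII.6) p.378 tl.5–22] -/
def limitE (lam : ℝ) : (N : ℕ) → WTestPrinted N → ℝ
  | 0, x => PEmpty.elim x
  | 1, x => PEmpty.elim x
  | _ + 2, x => finitaryWard T.toAxialTheory.Slim (x.data S lam)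

/-- **THE SLAVNOV CONJUNCT IS DEFINITIONAL WHILE `E_N` IS A FREE DATUM**: for every pinned theory whose ultraviolet limit
exists, with `E := limitE` (the limit of the printed left-hand side, which exists «by definition», p.378 tl.20–22) MRS's
main statement WITH the printed Slavnov data holds. [cite: MagnenRivasseauSeneor1993, p.327 tl.39–43, (VIII.6) p.378 tl.5–22] -/
theorem printedStatement_withPrintedSlavnov_limitE (lam : ℝ) (huv : UVLimitExistsPrinted T.toAxialTheory) :
    (T.withPrintedSlavnov S lam (T.limitE S lam)).PrintedStatement := by
  rw [T.printedStatement_withPrintedSlavnov_iff]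
  refine ⟨huv, fun n x => ?_⟩
  have hlim := tendsto_finitaryWard (G := fun ρ => T.schwinger ρ) (Glim := T.toAxialTheory.Slim)
    (fun k f => T.tendsto_schwinger_Slim huv k f) (x.data S lam)
  have hre : (fun ρ => finitaryWard (T.schwinger ρ) (x.data S lam)) = fun ρ => (∫ A, x.W S lam A ∂(T.law ρ)).re :=
    funext fun ρ => T.finitaryWard_wardDataN S lam x.K x.d x.a x.m x.L x.e x.b ρ
  rw [hre] at hlim
  exact hlim

/-- Hence MRS's statement with the printed Slavnov side is EQUIVALENT to its first conjunct up to the choice of the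
unprinted datum `E`: `UVLimitExistsPrinted T ↔ ∃ E, (T.withPrintedSlavnov S λ E).PrintedStatement`.
[cite: MagnenRivasseauSeneor1993, p.327 tl.39–43, (VIII.6) p.378 tl.5–22] -/
theorem uvLimit_iff_exists_E_printedStatement (lam : ℝ) :
    UVLimitExistsPrinted T.toAxialTheory ↔ ∃ E, (T.withPrintedSlavnov S lam E).PrintedStatement :=
  ⟨fun huv => ⟨T.limitE S lam, T.printedStatement_withPrintedSlavnov_limitE S lam huv⟩,
    fun ⟨E, h⟩ => (T.uvLimit_withPrintedSlavnov_iff S lam E).mp h.1⟩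

end PinnedTheory

end MainStatement

end Literature.MathematicalPhysics.QuantumFieldTheory.MagnenRivasseauSeneor1993
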